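import Literature.Barriers.CriticalPhenomena.LaceExpansionIsingGreenDecay
import Literature.Barriers.CriticalPhenomena.LaceExpansionKernelDerivatives
import Literature.Barriers.CriticalPhenomena.LaceExpansionSymbolCalculus
import Literature.Barriers.CriticalPhenomena.LaceExpansionTorusIntegrals
import Mathlib.Algebra.BigOperators.Module
import HarnessLib

/-!
# The symbols `D̂`, `D̂_nn` along coordinate slices: derivatives, moments, the matched Taylor
# bounds of `Ê = Â_ν - λF̂_μ`, and the Dirichlet-kernel bound `|∂_l^j D̂| ≤ 4L^j M_L`

Support file for the discharge of `LiuSlade2026_prop12_comparison` (Liu–Slade 2026, Prop. 1.2,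
(1.9); `LaceExpansionIsingGreenDecay.lean`). The proof bounds `d - 1` derivatives in one coordinate
direction `e_l` of the regularised symbol `1/F̂_μ - λ/Â_ν`, `F̂_μ = 1 - μD̂`, `Â_ν = 1 - νD̂_nn`,
pointwise on `[-π,π]^d`; this file supplies the ATOMS of that computation for Sakai's uniformly
spread-out step distribution `D = soStep d L` (symbol `D̂ = soSymbol d L`) and the nearest-neighbour
symbol `D̂_nn(k) = d⁻¹ Σ_i cos k_i` (`nnSymbol`). All PROVED:

* `soSymbolD d L l j k = Σ_y D(y) y_l^j cos(k·y + jπ/2)` — the `j`-th slice derivative of `D̂`: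
  `(d/dt)^j D̂(k[l↦t]) = soSymbolD … (k[l↦t])` (`iteratedDeriv_soSymbol_slice`); joint smoothness
  of `D̂`; the bounds `|soSymbolD_j| ≤ L^j`, `|soSymbolD_1(k)| ≤ dL²‖k‖_∞`;
* `nnSymbol`, `1 - D̂_nn = ε(k)/d` (`dispersion`), its slice derivatives `d⁻¹cos(k_l + jπ/2)`;
* second moments of `D` (from the `ℤ^d`-symmetry lemmas of `LaceExpansionKernelTaylor.lean`):
  `Σ_y D(y) y_l y_i = δ_{li} σ²/d`, `Σ_y D(y) y_l (k·y) = k_l σ²/d`, `Σ_y D(y)(k·y)² = |k|²σ²/d`;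
* the MATCHED TAYLOR BOUNDS: for parameters with `ν = λμσ²` (and `1 - ν = λ(1 - μ)` at order
  `0`), the combination `E = Â_ν - λF̂_μ` and its slice derivatives
  `E_j = -(ν/d)cos(k_l + jπ/2) + λμ soSymbolD_j` obey
  `|E| ≤ 10d³L²‖k‖⁴`, `|E_1| ≤ d²L²‖k‖³`, `|E_2| ≤ 2dL²‖k‖²`, `|E_3| ≤ 4L²‖k‖`,
  `|E_j| ≤ 1/d + λμL^j` (`λμ ≤ 3/(dL²)`, sup norm `‖k‖`) — the vanishing of the zeroth and second
  moments of `E` (Liu–Slade's (3.4), `Σ_x E(x) = Σ_x |x|²E(x) = 0`) in quantitative form;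
* Part 2, the DIRICHLET-KERNEL BOUND (the pointwise content of Liu–Slade's
  `‖D̂_α‖_q ≲ L^{|α|-d/q}`, Lemma 3.6, third display, proved in their App. B from the product
  structure of `D̂` and Hara–Slade 1990): for `j ≥ 1` and `k ∈ [-π,π]^d`,
  `|soSymbolD d L l j k| ≤ 4 L^j M_L(k)`, `M_L(k) = Π_i π/max(π, L|k_i|)` (`dirichletMajorant`,
  `LaceExpansionTorusIntegrals.lean`), and `|D̂(k)| ≤ 2M_L(k) + 1/N_L` — through the complex product
  formula `Σ_{y∈[-L,L]^d} y_l^j e^{ik·y} = (Σ_m m^j e^{ik_lm}) Π_{i≠l} G_L(k_i)`, the geometric bound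
  `|Σ_{m=1}^n e^{itm}| ≤ 1/|sin(t/2)|`, Abel summation `|Σ_{m=1}^n m^j e^{itm}| ≤ 2n^j/|sin(t/2)|`
  (`Finset.sum_range_by_parts`), and the two-regime bounds `|G_L(t)| ≤ (2L+1)m_L(t)`,
  `|Σ_{|m|≤L} m^je^{itm}| ≤ 2(2L+1)L^j m_L(t)` (Jordan: `|sin(t/2)| ≥ |t|/π`).

## References

Section and equation numbers are those of the arXiv version held in the literature store, whose
§5 "Spread-out Green function" (Lemmas 5.1–5.2) is Appendix A (Lemmas A.1–A.2) of the journal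
version.

* Y. Liu, G. Slade, *Gaussian deconvolution and the lace expansion for spread-out models*,
  Ann. Inst. H. Poincaré Probab. Statist. 62 (2026), arXiv:2310.07640: §5 = App. A (the
  decomposition `E = A - σ^{-2}F` with vanishing zeroth and second moments; Lemma 5.2 = A.2 and its
  proof: Taylor expansion of `Ê_γ`, `Σ_x |x|²|E(x)| ≤ 2`), §3.1 (`E_{z,λ,μ} = A_μ - λF_z` and the moment
  conditions (3.4)), Lemma 3.4, Lemma 3.6 (third display: `‖D̂_α‖_q ≲ L^{|α|-d/q}`) and App. B
  (its proof: "we apply [HS90a, (5.20)] … `∫_{R_S} |D̂_α|^q ≲ L^{q|α|} ∫ Π_{i∈S} |Lk_i|^{-q}`")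
  [LiuSlade2026].
* T. Hara, Ann. Probab. 36 (2008) 530–593, proof of Lemma 2.1 (isotropy of the second moments
  of a `ℤ^d`-symmetric kernel) [Hara2008].
-/

noncomputable section

namespace Literature.Barriers.CriticalPhenomena.SpreadOutIsing

open _root_.MeasureTheory Filter _root_.Topology Finset Literature.Probability.LatticeModels
open scoped BigOperators Real

variable {d L : ℕ}

/-! ## Geometry of the neighbourhood of the origin -/

/-- Coordinates of neighbours of the origin are at most `L`. [folklore] -/
theorem abs_apply_le_of_mem_neighborFinset {y : Site d}
    (hy : y ∈ (spreadOutGraph d L).neighborFinset 0) (i : Fin d) : |((y i : ℤ) : ℝ)| ≤ L := by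
  rw [SimpleGraph.mem_neighborFinset, spreadOutGraph_adj_iff] at hy
  have h := hy.2 i
  rw [Pi.zero_apply, zero_sub, abs_neg] at h
  exact_mod_cast h

/-- `|k·y| ≤ d L ‖k‖_∞` for neighbours `y` of the origin. [folklore] -/
theorem abs_kdot_le_of_mem_neighborFinset (k : Fin d → ℝ) {y : Site d}
    (hy : y ∈ (spreadOutGraph d L).neighborFinset 0) : |kdot k y| ≤ d * L * ‖k‖ := by
  unfold kdot
  calc |∑ j, k j * ((y j : ℤ) : ℝ)| ≤ ∑ j, |k j * ((y j : ℤ) : ℝ)| := Finset.abs_sum_le_sum_abs _ _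
    _ ≤ ∑ _j : Fin d, ‖k‖ * L := by
        refine Finset.sum_le_sum fun j _ => ?_
        rw [abs_mul]
        refine mul_le_mul ?_ (abs_apply_le_of_mem_neighborFinset hy j) (abs_nonneg _) (norm_nonneg _)
        rw [← Real.norm_eq_abs]; exact norm_le_pi_norm k j
    _ = d * L * ‖k‖ := by
        rw [Finset.sum_const, Finset.card_univ, Fintype.card_fin, nsmul_eq_mul]; ring

/-- `|y_l|^j ≤ L^j` for neighbours `y` of the origin. [folklore] -/
theorem abs_apply_pow_le_of_mem_neighborFinset {y : Site d}
    (hy : y ∈ (spreadOutGraph d L).neighborFinset 0) (l : Fin d) (j : ℕ) :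
    |((y l : ℤ) : ℝ) ^ j| ≤ (L : ℝ) ^ j := by
  rw [abs_pow]; exact pow_le_pow_left₀ (abs_nonneg _) (abs_apply_le_of_mem_neighborFinset hy l) j

/-! ## The slice derivatives `soSymbolD` of `D̂` -/

/-- The `j`-th derivative of `D̂` in the direction `e_l`:
`soSymbolD d L l j k = Σ_y D(y) y_l^j cos(k·y + jπ/2)` (`= ∂_l^j Σ_y D(y)cos(k·y)`).
[cite: LiuSlade2026, App. B (D̂_α = ∂^α D̂, |D̂_α(k)| ≤ Σ_x |x^α| D(x))] -/
def soSymbolD (d L : ℕ) (l : Fin d) (j : ℕ) (k : Fin d → ℝ) : ℝ :=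
  ∑ y ∈ (spreadOutGraph d L).neighborFinset 0,
    soStep d L y * (((y l : ℤ) : ℝ) ^ j * Real.cos (kdot k y + j * (π / 2)))

/-- `soSymbolD … 0 = D̂`. [folklore] -/
theorem soSymbolD_zero (l : Fin d) (k : Fin d → ℝ) : soSymbolD d L l 0 k = soSymbol d L k := by
  unfold soSymbolD soSymbol
  exact Finset.sum_congr rfl fun y _ => by simp

/-- The slice of `k·y`: `(k[l↦t])·y = y_l t + (k·y - k_l y_l)`. [folklore] -/
theorem kdot_update_eq_affine (k : Fin d → ℝ) (l : Fin d) (t : ℝ) (y : Site d) :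
    kdot (Function.update k l t) y = ((y l : ℤ) : ℝ) * t + (kdot k y - k l * ((y l : ℤ) : ℝ)) := by
  rw [kdot_update]; ring

/-- `D̂` along a slice is a finite sum of `cos(a_y t + b_y)`. [folklore] -/
theorem soSymbol_update (k : Fin d → ℝ) (l : Fin d) (t : ℝ) :
    soSymbol d L (Function.update k l t) = ∑ y ∈ (spreadOutGraph d L).neighborFinset 0,
      soStep d L y * Real.cos (((y l : ℤ) : ℝ) * t + (kdot k y - k l * ((y l : ℤ) : ℝ))) := by
  unfold soSymbol
  exact Finset.sum_congr rfl fun y _ => by rw [kdot_update_eq_affine]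

/-- `k ↦ k·y` is smooth (linear). [folklore] -/
theorem contDiff_kdot (y : Site d) {n : WithTop ℕ∞} : ContDiff ℝ n fun k : Fin d → ℝ => kdot k y :=
  ContDiff.sum fun j _ => (contDiff_apply ℝ ℝ j).mul contDiff_const

/-- **`D̂` is smooth on `ℝ^d`** (a trigonometric polynomial). [folklore] -/
theorem contDiff_soSymbol {n : WithTop ℕ∞} : ContDiff ℝ n (soSymbol d L) := by
  unfold soSymbol
  exact ContDiff.sum fun y _ => contDiff_const.mul (Real.contDiff_cos.comp (contDiff_kdot y))

/-- The slice `t ↦ D̂(k[l↦t])` is smooth. [folklore] -/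
theorem contDiff_soSymbol_slice (k : Fin d → ℝ) (l : Fin d) {n : WithTop ℕ∞} :
    ContDiff ℝ n fun t : ℝ => soSymbol d L (Function.update k l t) := by
  simp_rw [soSymbol_update]
  exact ContDiff.sum fun y _ => contDiff_const.mul (contDiff_cos_affine _ _)

/-- **Slice derivatives of `D̂`**: `(d/dt)^j D̂(k[l↦t]) |_{t=s} = soSymbolD d L l j (k[l↦s])`.
[cite: LiuSlade2026, App. B (D̂_α = ∂^α D̂)] -/
theorem iteratedDeriv_soSymbol_slice (j : ℕ) (k : Fin d → ℝ) (l : Fin d) (s : ℝ) :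
    iteratedDeriv j (fun t : ℝ => soSymbol d L (Function.update k l t)) s =
      soSymbolD d L l j (Function.update k l s) := by
  simp_rw [soSymbol_update]
  rw [iteratedDeriv_fun_sum fun y _ =>
    ((contDiff_const.mul (contDiff_cos_affine _ _)).contDiffAt : ContDiffAt ℝ j _ s)]
  unfold soSymbolD
  refine Finset.sum_congr rfl fun y _ => ?_
  rw [show (fun t : ℝ => soStep d L y * Real.cos (((y l : ℤ) : ℝ) * t + (kdot k y - k l * ((y l : ℤ) : ℝ)))) =
      fun t => soStep d L y * (fun t : ℝ => Real.cos (((y l : ℤ) : ℝ) * t +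
        (kdot k y - k l * ((y l : ℤ) : ℝ)))) t from rfl,
    iteratedDeriv_const_mul _ ((contDiff_cos_affine _ _).contDiffAt), iteratedDeriv_cos_affine,
    kdot_update_eq_affine]

/-- **`|soSymbolD_j(k)| ≤ L^j`** (`d, L ≥ 1`). [cite: LiuSlade2026, App. B (|D̂_α(k)| ≤ Σ_x |x^α| D(x) ≤ L^{|α|})] -/
theorem abs_soSymbolD_le (hd : 1 ≤ d) (hL : 1 ≤ L) (l : Fin d) (j : ℕ) (k : Fin d → ℝ) :
    |soSymbolD d L l j k| ≤ (L : ℝ) ^ j := by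
  unfold soSymbolD
  refine (Finset.abs_sum_le_sum_abs _ _).trans ?_
  calc ∑ y ∈ (spreadOutGraph d L).neighborFinset 0,
        |soStep d L y * (((y l : ℤ) : ℝ) ^ j * Real.cos (kdot k y + j * (π / 2)))|
      ≤ ∑ y ∈ (spreadOutGraph d L).neighborFinset 0, soStep d L y * (L : ℝ) ^ j := by
        refine Finset.sum_le_sum fun y hy => ?_
        rw [abs_mul, abs_of_nonneg (soStep_nonneg y), abs_mul]
        refine mul_le_mul_of_nonneg_left ?_ (soStep_nonneg y)
        calc |((y l : ℤ) : ℝ) ^ j| * |Real.cos (kdot k y + j * (π / 2))|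
            ≤ (L : ℝ) ^ j * 1 := mul_le_mul (abs_apply_pow_le_of_mem_neighborFinset hy l j)
              (Real.abs_cos_le_one _) (abs_nonneg _) (by positivity)
          _ = (L : ℝ) ^ j := mul_one _
    _ = (L : ℝ) ^ j := by rw [← Finset.sum_mul, sum_soStep_eq_one hd hL, one_mul]

/-- `soSymbolD_1(k) = -Σ_y D(y) y_l sin(k·y)`. [folklore] -/
theorem soSymbolD_one (l : Fin d) (k : Fin d → ℝ) : soSymbolD d L l 1 k =
    -∑ y ∈ (spreadOutGraph d L).neighborFinset 0, soStep d L y * (((y l : ℤ) : ℝ) * Real.sin (kdot k y)) := by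
  unfold soSymbolD
  rw [← Finset.sum_neg_distrib]
  refine Finset.sum_congr rfl fun y _ => ?_
  rw [Nat.cast_one, one_mul, pow_one, Real.cos_add_pi_div_two]; ring

/-- `soSymbolD_2(k) = -Σ_y D(y) y_l² cos(k·y)`. [folklore] -/
theorem soSymbolD_two (l : Fin d) (k : Fin d → ℝ) : soSymbolD d L l 2 k =
    -∑ y ∈ (spreadOutGraph d L).neighborFinset 0, soStep d L y * (((y l : ℤ) : ℝ) ^ 2 * Real.cos (kdot k y)) := by
  unfold soSymbolD
  rw [← Finset.sum_neg_distrib]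
  refine Finset.sum_congr rfl fun y _ => ?_
  rw [show ((2 : ℕ) : ℝ) * (π / 2) = π by push_cast; ring, Real.cos_add_pi]; ring

/-- `cos(u + 3π/2) = sin u`. [folklore] -/
theorem cos_add_three_pi_div_two (u : ℝ) : Real.cos (u + ((3 : ℕ) : ℝ) * (π / 2)) = Real.sin u := by
  rw [show u + ((3 : ℕ) : ℝ) * (π / 2) = (u + π / 2) + π by push_cast; ring, Real.cos_add_pi,
    Real.cos_add_pi_div_two, neg_neg]

/-- `soSymbolD_3(k) = Σ_y D(y) y_l³ sin(k·y)`. [folklore] -/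
theorem soSymbolD_three (l : Fin d) (k : Fin d → ℝ) : soSymbolD d L l 3 k =
    ∑ y ∈ (spreadOutGraph d L).neighborFinset 0, soStep d L y * (((y l : ℤ) : ℝ) ^ 3 * Real.sin (kdot k y)) := by
  unfold soSymbolD
  refine Finset.sum_congr rfl fun y _ => ?_
  rw [cos_add_three_pi_div_two]

/-- **`|soSymbolD_1(k)| ≤ dL²‖k‖_∞`** (`|sin(k·y)| ≤ |k·y| ≤ dL‖k‖_∞`, `|y_l| ≤ L`).
[cite: LiuSlade2026, proof of Lemma 3.3 ("Taylor's Theorem and symmetry give |Â_γ(k)| ≲ L²|k|" for |γ| = 1)] -/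
theorem abs_soSymbolD_one_le (hd : 1 ≤ d) (hL : 1 ≤ L) (l : Fin d) (k : Fin d → ℝ) :
    |soSymbolD d L l 1 k| ≤ d * (L : ℝ) ^ 2 * ‖k‖ := by
  rw [soSymbolD_one, abs_neg]
  refine (Finset.abs_sum_le_sum_abs _ _).trans ?_
  calc ∑ y ∈ (spreadOutGraph d L).neighborFinset 0, |soStep d L y * (((y l : ℤ) : ℝ) * Real.sin (kdot k y))|
      ≤ ∑ y ∈ (spreadOutGraph d L).neighborFinset 0, soStep d L y * ((L : ℝ) * (d * L * ‖k‖)) := by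
        refine Finset.sum_le_sum fun y hy => ?_
        rw [abs_mul, abs_of_nonneg (soStep_nonneg y), abs_mul]
        refine mul_le_mul_of_nonneg_left ?_ (soStep_nonneg y)
        exact mul_le_mul (abs_apply_le_of_mem_neighborFinset hy l)
          ((Real.abs_sin_le_abs).trans (abs_kdot_le_of_mem_neighborFinset k hy)) (abs_nonneg _)
          (Nat.cast_nonneg _)
    _ = d * (L : ℝ) ^ 2 * ‖k‖ := by rw [← Finset.sum_mul, sum_soStep_eq_one hd hL, one_mul]; ring

/-! ## The nearest-neighbour symbol `D̂_nn` -/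

/-- The nearest-neighbour symbol `D̂_nn(k) = d⁻¹ Σ_i cos k_i`. [cite: LiuSlade2026, §5, proof of Lemma 5.1 ((5.8): Ĉ_1 = 1/(1 - D̂_nn), D̂_nn(k) = d⁻¹ Σ_j cos k_j)] -/
def nnSymbol (k : Fin d → ℝ) : ℝ := (∑ i, Real.cos (k i)) / d

/-- `1 - D̂_nn(k) = ε(k)/d` with `ε(k) = Σ_i (1 - cos k_i)` the tree's `dispersion`. [folklore] -/
theorem one_sub_nnSymbol (hd : 1 ≤ d) (k : Fin d → ℝ) : 1 - nnSymbol k = dispersion k / d := by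
  have hd0 : (d : ℝ) ≠ 0 := by exact_mod_cast (by omega : d ≠ 0)
  unfold nnSymbol dispersion
  rw [Finset.sum_sub_distrib, Finset.sum_const, Finset.card_univ, Fintype.card_fin, nsmul_eq_mul, mul_one]
  field_simp

/-- `|D̂_nn(k)| ≤ 1`. [folklore] -/
theorem abs_nnSymbol_le_one (k : Fin d → ℝ) : |nnSymbol k| ≤ 1 := by
  rcases Nat.eq_zero_or_pos d with hd | hd
  · subst hd; simp [nnSymbol]
  have hd0 : (0 : ℝ) < d := by exact_mod_cast hd
  unfold nnSymbol
  rw [abs_div, abs_of_pos hd0, div_le_one hd0]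
  calc |∑ i, Real.cos (k i)| ≤ ∑ i, |Real.cos (k i)| := Finset.abs_sum_le_sum_abs _ _
    _ ≤ ∑ _i : Fin d, (1 : ℝ) := Finset.sum_le_sum fun i _ => Real.abs_cos_le_one _
    _ = d := by simp

/-- `D̂_nn` is smooth on `ℝ^d`. [folklore] -/
theorem contDiff_nnSymbol {n : WithTop ℕ∞} : ContDiff ℝ n (nnSymbol : (Fin d → ℝ) → ℝ) := by
  unfold nnSymbol
  exact (ContDiff.sum fun i _ => Real.contDiff_cos.comp (contDiff_apply ℝ ℝ i)).div_const _

/-- `D̂_nn` along a slice: `D̂_nn(k[l↦t]) = (cos t + Σ_{i≠l} cos k_i)/d`. [folklore] -/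
theorem nnSymbol_update (k : Fin d → ℝ) (l : Fin d) (t : ℝ) :
    nnSymbol (Function.update k l t) =
      (Real.cos t + ∑ i ∈ Finset.univ.erase l, Real.cos (k i)) / d := by
  unfold nnSymbol
  congr 1
  rw [← Finset.add_sum_erase Finset.univ _ (Finset.mem_univ l), Function.update_self]
  congr 1
  exact Finset.sum_congr rfl fun i hi => by rw [Function.update_of_ne (Finset.ne_of_mem_erase hi)]

/-- The slice `t ↦ D̂_nn(k[l↦t])` is smooth. [folklore] -/
theorem contDiff_nnSymbol_slice (k : Fin d → ℝ) (l : Fin d) {n : WithTop ℕ∞} :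
    ContDiff ℝ n fun t : ℝ => nnSymbol (Function.update k l t) := by
  simp_rw [nnSymbol_update]
  exact (Real.contDiff_cos.add contDiff_const).div_const _

/-- **Slice derivatives of `D̂_nn`**: `(d/dt)^j D̂_nn(k[l↦t])|_{t=s} = d⁻¹ cos(s + jπ/2)` (`j ≥ 1`).
[folklore] -/
theorem iteratedDeriv_nnSymbol_slice {j : ℕ} (hj : 1 ≤ j) (k : Fin d → ℝ) (l : Fin d) (s : ℝ) :
    iteratedDeriv j (fun t : ℝ => nnSymbol (Function.update k l t)) s = Real.cos (s + j * (π / 2)) / d := by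
  simp_rw [nnSymbol_update]
  have h1 : (fun t : ℝ => (Real.cos t + ∑ i ∈ Finset.univ.erase l, Real.cos (k i)) / d) =
      fun t => (d : ℝ)⁻¹ * (fun t : ℝ => (∑ i ∈ Finset.univ.erase l, Real.cos (k i)) +
        Real.cos (1 * t + 0)) t := by
    funext t; simp [div_eq_inv_mul, add_comm]
  rw [h1, iteratedDeriv_const_mul _ ((contDiff_const.add (contDiff_cos_affine 1 0)).contDiffAt),
    iteratedDeriv_const_add (by omega), iteratedDeriv_cos_affine]
  simp [div_eq_inv_mul, mul_comm]

/-! ## Second moments of `D` -/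

/-- Finite sums over the neighbourhood of the origin are the corresponding series (`D` vanishes
elsewhere). [folklore] -/
theorem tsum_mul_soStep_eq_sum (g : Site d → ℝ) :
    ∑' y, g y * soStep d L y = ∑ y ∈ (spreadOutGraph d L).neighborFinset 0, g y * soStep d L y :=
  tsum_eq_sum fun y hy => by
    rw [soStep_of_not_adj fun h => hy ((SimpleGraph.mem_neighborFinset _ _ _).2 h), mul_zero]

/-- `Σ_y |y|² D(y) = σ²`. [cite: Sakai2007, §1.2 (σ² = Σ_x |x|² D(x))] -/
theorem sum_euclidNorm_sq_mul_soStep :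
    ∑ y ∈ (spreadOutGraph d L).neighborFinset 0, euclidNorm y ^ 2 * soStep d L y = soVariance d L := by
  unfold soVariance
  refine Finset.sum_congr rfl fun y hy => ?_
  rw [soStep, if_pos ((SimpleGraph.mem_neighborFinset _ _ _).1 hy)]

/-- **Off-diagonal second moments vanish**: `Σ_y D(y) y_l y_i = 0` for `i ≠ l`.
[cite: LiuSlade2026, Def. 1.1 (D is ℤ^d-symmetric)] -/
theorem sum_soStep_mul_apply_mul_apply {l i : Fin d} (hli : l ≠ i) :
    ∑ y ∈ (spreadOutGraph d L).neighborFinset 0,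
      ((y l : ℤ) : ℝ) * ((y i : ℤ) : ℝ) * soStep d L y = 0 := by
  rw [← tsum_mul_soStep_eq_sum fun y : Site d => ((y l : ℤ) : ℝ) * ((y i : ℤ) : ℝ)]
  exact tsum_apply_mul_apply_mul_eq_zero isZdSymmetric_soStep hli

/-- **Diagonal second moments**: `Σ_y D(y) y_l² = σ²/d`. [cite: LiuSlade2026, Def. 1.1 (D is ℤ^d-symmetric)] -/
theorem sum_soStep_mul_sq (l : Fin d) :
    ∑ y ∈ (spreadOutGraph d L).neighborFinset 0, ((y l : ℤ) : ℝ) ^ 2 * soStep d L y =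
      soVariance d L / d := by
  have hs : Summable fun y : Site d => euclidNorm y ^ 2 * |soStep d L y| :=
    summable_of_ne_finset_zero (s := (spreadOutGraph d L).neighborFinset 0) fun y hy => by
      rw [soStep_of_not_adj fun h => hy ((SimpleGraph.mem_neighborFinset _ _ _).2 h), abs_zero,
        mul_zero]
  rw [← tsum_mul_soStep_eq_sum fun y : Site d => ((y l : ℤ) : ℝ) ^ 2,
    tsum_sq_apply_mul_eq isZdSymmetric_soStep hs l, tsum_mul_soStep_eq_sum, sum_euclidNorm_sq_mul_soStep]

/-- **`Σ_y D(y) y_l (k·y) = k_l σ²/d`** (the first-order matching moment). [cite: LiuSlade2026, Def. 1.1 (D is ℤ^d-symmetric)] -/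
theorem sum_soStep_mul_apply_mul_kdot (l : Fin d) (k : Fin d → ℝ) :
    ∑ y ∈ (spreadOutGraph d L).neighborFinset 0, soStep d L y * (((y l : ℤ) : ℝ) * kdot k y) =
      k l * (soVariance d L / d) := by
  have hexp : ∀ y : Site d, soStep d L y * (((y l : ℤ) : ℝ) * kdot k y) =
      ∑ i, k i * (((y l : ℤ) : ℝ) * ((y i : ℤ) : ℝ) * soStep d L y) := by
    intro y
    unfold kdot
    rw [Finset.mul_sum, Finset.mul_sum]
    exact Finset.sum_congr rfl fun i _ => by ring
  rw [Finset.sum_congr rfl fun y _ => hexp y, Finset.sum_comm]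
  simp_rw [← Finset.mul_sum]
  rw [← Finset.add_sum_erase Finset.univ _ (Finset.mem_univ l)]
  have h0 : ∑ i ∈ Finset.univ.erase l, k i * ∑ y ∈ (spreadOutGraph d L).neighborFinset 0,
      ((y l : ℤ) : ℝ) * ((y i : ℤ) : ℝ) * soStep d L y = 0 :=
    Finset.sum_eq_zero fun i hi => by
      rw [sum_soStep_mul_apply_mul_apply (Finset.ne_of_mem_erase hi).symm, mul_zero]
  rw [h0, add_zero, ← sum_soStep_mul_sq l]
  congr 1
  exact Finset.sum_congr rfl fun y _ => by ring

/-- **`Σ_y D(y)(k·y)² = |k|₂² σ²/d`** (isotropy of the quadratic form). [cite: LiuSlade2026, Def. 1.1 (D is ℤ^d-symmetric)] -/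
theorem sum_soStep_mul_kdot_sq (k : Fin d → ℝ) :
    ∑ y ∈ (spreadOutGraph d L).neighborFinset 0, soStep d L y * kdot k y ^ 2 =
      (∑ i, k i ^ 2) * (soVariance d L / d) := by
  have hs : Summable fun y : Site d => euclidNorm y ^ 2 * |soStep d L y| :=
    summable_of_ne_finset_zero (s := (spreadOutGraph d L).neighborFinset 0) fun y hy => by
      rw [soStep_of_not_adj fun h => hy ((SimpleGraph.mem_neighborFinset _ _ _).2 h), abs_zero,
        mul_zero]
  have h := tsum_kdot_sq_mul isZdSymmetric_soStep hs k
  rw [tsum_mul_soStep_eq_sum, tsum_mul_soStep_eq_sum, sum_euclidNorm_sq_mul_soStep] at h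
  rw [Finset.sum_congr rfl fun y _ => mul_comm (soStep d L y) (kdot k y ^ 2), h]
  ring

/-! ## Elementary Taylor bounds -/

/-- `|1 - cos u - u²/2| ≤ (5/2) u⁴` (from the tree's Hölder form with `θ = 2`). [folklore] -/
theorem abs_one_sub_cos_sub_sq_le_pow_four (u : ℝ) : |1 - Real.cos u - u ^ 2 / 2| ≤ 5 / 2 * u ^ 4 := by
  have h := abs_one_sub_cos_sub_sq_le u (θ := 2) (by norm_num) (by norm_num)
  have h4 : |u| ^ ((2 : ℝ) + 2) = u ^ 4 := by
    rw [show (2 : ℝ) + 2 = ((4 : ℕ) : ℝ) by norm_num, Real.rpow_natCast, pow_abs,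
      abs_of_nonneg (by positivity)]
  rwa [h4] at h

/-- `0 ≤ 1 - cos u ≤ u²/2`, as `|1 - cos u| ≤ u²/2`. [folklore] -/
theorem abs_one_sub_cos_le (u : ℝ) : |1 - Real.cos u| ≤ u ^ 2 / 2 := by
  rw [abs_of_nonneg (sub_nonneg.2 (Real.cos_le_one u))]
  linarith [Real.one_sub_sq_div_two_le_cos (x := u)]

/-- `|sin u - u| ≤ |u|³/6`. [folklore] -/
theorem abs_sin_sub_le (u : ℝ) : |Real.sin u - u| ≤ |u| ^ 3 / 6 := by
  rw [abs_sub_comm]; exact Real.abs_sub_sin_le u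

/-- `|k_i| ≤ ‖k‖_∞`. [folklore] -/
theorem abs_apply_le_norm (k : Fin d → ℝ) (i : Fin d) : |k i| ≤ ‖k‖ := by
  rw [← Real.norm_eq_abs]; exact norm_le_pi_norm k i

/-! ## The matched combination `E = Â_ν - λF̂_μ` -/

/-- The combination `E(k) = Â_ν(k) - λF̂_μ(k) = (1 - νD̂_nn(k)) - λ(1 - μD̂(k))` of the two
regularised symbols (Liu–Slade's `E_{z,λ,μ} = A_μ - λF_z` of §3.1, for the pair `(D̂_nn, D̂)` of App. A, with
masses). [cite: LiuSlade2026, §3.1 (E_{z,λ,μ} = A_μ - λF_z) and §5 = App. A (E = A - σ^{-2}F)] -/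
def eSymbol (d L : ℕ) (μ ν lam : ℝ) (k : Fin d → ℝ) : ℝ :=
  (1 - ν * nnSymbol k) - lam * (1 - μ * soSymbol d L k)

/-- Its slice derivatives `E_j(k) = -(ν/d)cos(k_l + jπ/2) + λμ soSymbolD_j(k)` (`j ≥ 1`).
[cite: LiuSlade2026, §5 = App. A (Ê_γ in the proof of Lemma 5.2 = A.2)] -/
def eSymbolD (d L : ℕ) (μ ν lam : ℝ) (l : Fin d) (j : ℕ) (k : Fin d → ℝ) : ℝ :=
  -(ν / d) * Real.cos (k l + j * (π / 2)) + lam * μ * soSymbolD d L l j k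

/-- The slice `t ↦ E(k[l↦t])` is smooth. [folklore] -/
theorem contDiff_eSymbol_slice (μ ν lam : ℝ) (k : Fin d → ℝ) (l : Fin d) {n : WithTop ℕ∞} :
    ContDiff ℝ n fun t : ℝ => eSymbol d L μ ν lam (Function.update k l t) :=
  (contDiff_const.sub (contDiff_const.mul (contDiff_nnSymbol_slice k l))).sub
    (contDiff_const.mul (contDiff_const.sub (contDiff_const.mul (contDiff_soSymbol_slice k l))))

/-- `E` is smooth on `ℝ^d`. [folklore] -/
theorem contDiff_eSymbol (μ ν lam : ℝ) {n : WithTop ℕ∞} : ContDiff ℝ n (eSymbol d L μ ν lam) :=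
  (contDiff_const.sub (contDiff_const.mul contDiff_nnSymbol)).sub
    (contDiff_const.mul (contDiff_const.sub (contDiff_const.mul contDiff_soSymbol)))

/-- **Slice derivatives of `E`**: `(d/dt)^j E(k[l↦t])|_{t=s} = E_j(k[l↦s])` for `j ≥ 1`. [folklore] -/
theorem iteratedDeriv_eSymbol_slice {j : ℕ} (hj : 1 ≤ j) (μ ν lam : ℝ) (k : Fin d → ℝ) (l : Fin d)
    (s : ℝ) :
    iteratedDeriv j (fun t : ℝ => eSymbol d L μ ν lam (Function.update k l t)) s =
      eSymbolD d L μ ν lam l j (Function.update k l s) := by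
  have hA : ContDiff ℝ j fun t : ℝ => nnSymbol (Function.update k l t) := contDiff_nnSymbol_slice k l
  have hF : ContDiff ℝ j fun t : ℝ => soSymbol d L (Function.update k l t) := contDiff_soSymbol_slice k l
  have h1 : (fun t : ℝ => eSymbol d L μ ν lam (Function.update k l t)) =
      fun t => (1 - lam) + ((-ν) * nnSymbol (Function.update k l t) +
        (lam * μ) * soSymbol d L (Function.update k l t)) := by
    funext t; simp only [eSymbol]; ring
  rw [h1, iteratedDeriv_const_add (by omega),
    iteratedDeriv_fun_add ((contDiff_const.mul hA).contDiffAt) ((contDiff_const.mul hF).contDiffAt),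
    show (fun t : ℝ => -ν * nnSymbol (Function.update k l t)) =
      fun t => -ν * (fun t : ℝ => nnSymbol (Function.update k l t)) t from rfl,
    iteratedDeriv_const_mul _ hA.contDiffAt,
    show (fun t : ℝ => lam * μ * soSymbol d L (Function.update k l t)) =
      fun t => (lam * μ) * (fun t : ℝ => soSymbol d L (Function.update k l t)) t from rfl,
    iteratedDeriv_const_mul _ hF.contDiffAt, iteratedDeriv_nnSymbol_slice hj,
    iteratedDeriv_soSymbol_slice]
  simp only [eSymbolD, Function.update_self]
  ring

/-- `E` rewritten through the total mass `Σ_y D(y) = 1` and the zeroth matching `1 - ν = λ(1 - μ)`: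
`E(k) = (ν/d) Σ_i (1 - cos k_i) - λμ Σ_y D(y)(1 - cos(k·y))`. [cite: LiuSlade2026, §5 = App. A (E has vanishing zeroth moment)] -/
theorem eSymbol_eq (hd : 1 ≤ d) (hL : 1 ≤ L) {μ ν lam : ℝ} (hm1 : 1 - ν = lam * (1 - μ))
    (k : Fin d → ℝ) :
    eSymbol d L μ ν lam k = ν / d * ∑ i, (1 - Real.cos (k i)) -
      lam * μ * ∑ y ∈ (spreadOutGraph d L).neighborFinset 0, soStep d L y * (1 - Real.cos (kdot k y)) := by
  have hnn : 1 - nnSymbol k = (∑ i, (1 - Real.cos (k i))) / d := by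
    rw [one_sub_nnSymbol hd]; rfl
  have hso : 1 - soSymbol d L k =
      ∑ y ∈ (spreadOutGraph d L).neighborFinset 0, soStep d L y * (1 - Real.cos (kdot k y)) := by
    simp_rw [mul_sub, Finset.sum_sub_distrib, mul_one, sum_soStep_eq_one hd hL, soSymbol]
  have e1 : eSymbol d L μ ν lam k = ((1 - ν) - lam * (1 - μ)) + (ν * (1 - nnSymbol k) -
      lam * μ * (1 - soSymbol d L k)) := by simp only [eSymbol]; ring
  rw [e1, hm1, sub_self, zero_add, hnn, hso]
  ring

/-- **Zeroth-order matched Taylor bound**: `|E(k)| ≤ 10 d³L² ‖k‖⁴_∞` when `ν = λμσ²`,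
`1 - ν = λ(1 - μ)`, `0 ≤ ν ≤ 1`, `0 ≤ λμ ≤ 3/(dL²)` (the vanishing of the zeroth and second moments of
`E`: the quadratic Taylor terms cancel, `Σ_y D(y)(k·y)² = |k|²σ²/d`).
[cite: LiuSlade2026, Lemma 3.4 and proof of Lemma 5.2 = A.2 (|Ê_γ(k)| ≲ Σ_x |k|^{2-|γ|}|x|²|E(x)|; here with the fourth-order remainder)] -/
theorem abs_eSymbol_le (hd : 1 ≤ d) (hL : 1 ≤ L) {μ ν lam : ℝ} (hν0 : 0 ≤ ν) (hν1 : ν ≤ 1)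
    (hlm0 : 0 ≤ lam * μ) (hlm : lam * μ ≤ 3 / (d * (L : ℝ) ^ 2)) (hm1 : 1 - ν = lam * (1 - μ))
    (hm2 : ν = lam * μ * soVariance d L) (k : Fin d → ℝ) :
    |eSymbol d L μ ν lam k| ≤ 10 * (d : ℝ) ^ 3 * (L : ℝ) ^ 2 * ‖k‖ ^ 4 := by
  have hd0 : (0 : ℝ) < d := by exact_mod_cast (by omega : 0 < d)
  have hL1 : (1 : ℝ) ≤ L := by exact_mod_cast hL
  set ρ := ‖k‖ with hρ
  set S := (spreadOutGraph d L).neighborFinset 0 with hS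
  set r : ℝ → ℝ := fun u => 1 - Real.cos u - u ^ 2 / 2 with hr
  -- the quadratic terms cancel
  have hquad : ν / d * ∑ i, (k i) ^ 2 / 2 - lam * μ * ∑ y ∈ S, soStep d L y * (kdot k y ^ 2 / 2) = 0 := by
    have h1 : ∑ y ∈ S, soStep d L y * (kdot k y ^ 2 / 2) = (∑ i, k i ^ 2) * (soVariance d L / d) / 2 := by
      rw [← sum_soStep_mul_kdot_sq, Finset.sum_div]
      exact Finset.sum_congr rfl fun y _ => by ring
    rw [h1, ← Finset.sum_div, hm2]
    field_simp
    ring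
  have hE : eSymbol d L μ ν lam k = ν / d * ∑ i, r (k i) - lam * μ * ∑ y ∈ S, soStep d L y * r (kdot k y) := by
    rw [eSymbol_eq hd hL hm1]
    have e1 : ∑ i, (1 - Real.cos (k i)) = ∑ i, (k i) ^ 2 / 2 + ∑ i, r (k i) := by
      rw [← Finset.sum_add_distrib]; exact Finset.sum_congr rfl fun i _ => by simp only [hr]; ring
    have e2 : ∑ y ∈ S, soStep d L y * (1 - Real.cos (kdot k y)) =
        ∑ y ∈ S, soStep d L y * (kdot k y ^ 2 / 2) + ∑ y ∈ S, soStep d L y * r (kdot k y) := by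
      rw [← Finset.sum_add_distrib]; exact Finset.sum_congr rfl fun y _ => by simp only [hr]; ring
    rw [← hS, e1, e2]
    linear_combination hquad
  -- bound the two remainders
  have hki : ∀ i, |r (k i)| ≤ 5 / 2 * ρ ^ 4 := fun i => by
    refine (abs_one_sub_cos_sub_sq_le_pow_four (k i)).trans ?_
    have : (k i) ^ 4 ≤ ρ ^ 4 := by
      rw [← (by decide : Even 4).pow_abs (k i)]
      exact pow_le_pow_left₀ (abs_nonneg _) (abs_apply_le_norm k i) 4
    linarith
  have hky : ∀ y ∈ S, |r (kdot k y)| ≤ 5 / 2 * ((d : ℝ) * L * ρ) ^ 4 := fun y hy => by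
    refine (abs_one_sub_cos_sub_sq_le_pow_four (kdot k y)).trans ?_
    have : (kdot k y) ^ 4 ≤ ((d : ℝ) * L * ρ) ^ 4 := by
      rw [← (by decide : Even 4).pow_abs (kdot k y)]
      exact pow_le_pow_left₀ (abs_nonneg _) (abs_kdot_le_of_mem_neighborFinset k hy) 4
    linarith
  have hA : |ν / d * ∑ i, r (k i)| ≤ 5 / 2 * ρ ^ 4 := by
    rw [abs_mul, abs_of_nonneg (by positivity : 0 ≤ ν / d)]
    calc ν / d * |∑ i, r (k i)| ≤ ν / d * ∑ i, |r (k i)| :=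
          mul_le_mul_of_nonneg_left (Finset.abs_sum_le_sum_abs _ _) (by positivity)
      _ ≤ ν / d * ∑ _i : Fin d, 5 / 2 * ρ ^ 4 :=
          mul_le_mul_of_nonneg_left (Finset.sum_le_sum fun i _ => hki i) (by positivity)
      _ = ν * (5 / 2 * ρ ^ 4) := by
          rw [Finset.sum_const, Finset.card_univ, Fintype.card_fin, nsmul_eq_mul]; field_simp
      _ ≤ 1 * (5 / 2 * ρ ^ 4) := mul_le_mul_of_nonneg_right hν1 (by positivity)
      _ = 5 / 2 * ρ ^ 4 := one_mul _
  have hB : |lam * μ * ∑ y ∈ S, soStep d L y * r (kdot k y)| ≤ 15 / 2 * (d : ℝ) ^ 3 * L ^ 2 * ρ ^ 4 := by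
    rw [abs_mul, abs_of_nonneg hlm0]
    have hsum : |∑ y ∈ S, soStep d L y * r (kdot k y)| ≤ 5 / 2 * ((d : ℝ) * L * ρ) ^ 4 := by
      calc |∑ y ∈ S, soStep d L y * r (kdot k y)| ≤ ∑ y ∈ S, |soStep d L y * r (kdot k y)| :=
            Finset.abs_sum_le_sum_abs _ _
        _ ≤ ∑ y ∈ S, soStep d L y * (5 / 2 * ((d : ℝ) * L * ρ) ^ 4) := by
            refine Finset.sum_le_sum fun y hy => ?_
            rw [abs_mul, abs_of_nonneg (soStep_nonneg y)]
            exact mul_le_mul_of_nonneg_left (hky y hy) (soStep_nonneg y)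
        _ = 5 / 2 * ((d : ℝ) * L * ρ) ^ 4 := by rw [← Finset.sum_mul, hS, sum_soStep_eq_one hd hL, one_mul]
    calc lam * μ * |∑ y ∈ S, soStep d L y * r (kdot k y)|
        ≤ 3 / (d * (L : ℝ) ^ 2) * (5 / 2 * ((d : ℝ) * L * ρ) ^ 4) :=
          mul_le_mul hlm hsum (abs_nonneg _) (by positivity)
      _ = 15 / 2 * (d : ℝ) ^ 3 * L ^ 2 * ρ ^ 4 := by field_simp; ring
  have h1 : (1 : ℝ) ≤ (d : ℝ) ^ 3 * L ^ 2 := by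
    have : (1 : ℝ) ≤ d := by exact_mod_cast hd
    nlinarith [one_le_pow₀ (n := 3) this, one_le_pow₀ (n := 2) hL1]
  have hρ4 : 0 ≤ ρ ^ 4 := by positivity
  rw [hE]
  calc |ν / d * ∑ i, r (k i) - lam * μ * ∑ y ∈ S, soStep d L y * r (kdot k y)|
      ≤ |ν / d * ∑ i, r (k i)| + |lam * μ * ∑ y ∈ S, soStep d L y * r (kdot k y)| := abs_sub _ _
    _ ≤ 5 / 2 * ρ ^ 4 + 15 / 2 * (d : ℝ) ^ 3 * L ^ 2 * ρ ^ 4 := add_le_add hA hB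
    _ ≤ 10 * (d : ℝ) ^ 3 * (L : ℝ) ^ 2 * ρ ^ 4 := by nlinarith

/-- **First-order matched Taylor bound**: `|E_1(k)| ≤ d²L²‖k‖³_∞` when `ν = λμσ²`
(`E_1 = (ν/d) sin k_l - λμ Σ_y D(y) y_l sin(k·y)`, the linear terms cancel by
`Σ_y D(y) y_l (k·y) = k_l σ²/d`). [cite: LiuSlade2026, Lemma 3.4 and proof of Lemma 5.2 = A.2 (|Ê_γ(k)| ≲ |k|^{2+σ-|γ|})] -/
theorem abs_eSymbolD_one_le (hd : 1 ≤ d) (hL : 1 ≤ L) {μ ν lam : ℝ} (hν0 : 0 ≤ ν) (hν1 : ν ≤ 1)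
    (hlm0 : 0 ≤ lam * μ) (hlm : lam * μ ≤ 3 / (d * (L : ℝ) ^ 2))
    (hm2 : ν = lam * μ * soVariance d L) (l : Fin d) (k : Fin d → ℝ) :
    |eSymbolD d L μ ν lam l 1 k| ≤ (d : ℝ) ^ 2 * (L : ℝ) ^ 2 * ‖k‖ ^ 3 := by
  have hd0 : (0 : ℝ) < d := by exact_mod_cast (by omega : 0 < d)
  have hd1 : (1 : ℝ) ≤ d := by exact_mod_cast hd
  have hL1 : (1 : ℝ) ≤ L := by exact_mod_cast hL
  set ρ := ‖k‖ with hρ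
  set S := (spreadOutGraph d L).neighborFinset 0 with hS
  have hρ0 : 0 ≤ ρ := norm_nonneg _
  -- `E_1 = (ν/d)(sin k_l - k_l) - λμ Σ D y_l (sin(k·y) - k·y)`
  have hlin : ν / d * k l - lam * μ * ∑ y ∈ S, soStep d L y * (((y l : ℤ) : ℝ) * kdot k y) = 0 := by
    rw [hS, sum_soStep_mul_apply_mul_kdot, hm2]; field_simp; ring
  have hE : eSymbolD d L μ ν lam l 1 k = ν / d * (Real.sin (k l) - k l) -
      lam * μ * ∑ y ∈ S, soStep d L y * (((y l : ℤ) : ℝ) * (Real.sin (kdot k y) - kdot k y)) := by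
    have e1 : eSymbolD d L μ ν lam l 1 k = ν / d * Real.sin (k l) -
        lam * μ * ∑ y ∈ S, soStep d L y * (((y l : ℤ) : ℝ) * Real.sin (kdot k y)) := by
      simp only [eSymbolD, hS, soSymbolD_one, Nat.cast_one, one_mul, Real.cos_add_pi_div_two]; ring
    have e2 : ∑ y ∈ S, soStep d L y * (((y l : ℤ) : ℝ) * (Real.sin (kdot k y) - kdot k y)) =
        ∑ y ∈ S, soStep d L y * (((y l : ℤ) : ℝ) * Real.sin (kdot k y)) -
          ∑ y ∈ S, soStep d L y * (((y l : ℤ) : ℝ) * kdot k y) := by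
      rw [← Finset.sum_sub_distrib]; exact Finset.sum_congr rfl fun y _ => by ring
    rw [e1, e2]; linear_combination hlin
  have hA : |ν / d * (Real.sin (k l) - k l)| ≤ ρ ^ 3 / 6 := by
    rw [abs_mul, abs_of_nonneg (by positivity : 0 ≤ ν / d)]
    have h1 : |Real.sin (k l) - k l| ≤ ρ ^ 3 / 6 := by
      refine (abs_sin_sub_le (k l)).trans ?_
      have := pow_le_pow_left₀ (abs_nonneg _) (abs_apply_le_norm k l) 3
      linarith
    have h2 : ν / d ≤ 1 := (div_le_one hd0).2 (hν1.trans hd1)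
    calc ν / d * |Real.sin (k l) - k l| ≤ 1 * (ρ ^ 3 / 6) := mul_le_mul h2 h1 (abs_nonneg _) zero_le_one
      _ = ρ ^ 3 / 6 := one_mul _
  have hB : |lam * μ * ∑ y ∈ S, soStep d L y * (((y l : ℤ) : ℝ) * (Real.sin (kdot k y) - kdot k y))| ≤
      (d : ℝ) ^ 2 * L ^ 2 * ρ ^ 3 / 2 := by
    rw [abs_mul, abs_of_nonneg hlm0]
    have hsum : |∑ y ∈ S, soStep d L y * (((y l : ℤ) : ℝ) * (Real.sin (kdot k y) - kdot k y))| ≤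
        L * (((d : ℝ) * L * ρ) ^ 3 / 6) := by
      calc |∑ y ∈ S, soStep d L y * (((y l : ℤ) : ℝ) * (Real.sin (kdot k y) - kdot k y))|
          ≤ ∑ y ∈ S, |soStep d L y * (((y l : ℤ) : ℝ) * (Real.sin (kdot k y) - kdot k y))| :=
            Finset.abs_sum_le_sum_abs _ _
        _ ≤ ∑ y ∈ S, soStep d L y * (L * (((d : ℝ) * L * ρ) ^ 3 / 6)) := by
            refine Finset.sum_le_sum fun y hy => ?_
            rw [abs_mul, abs_of_nonneg (soStep_nonneg y), abs_mul]
            refine mul_le_mul_of_nonneg_left ?_ (soStep_nonneg y)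
            refine mul_le_mul (abs_apply_le_of_mem_neighborFinset hy l) ?_ (abs_nonneg _) (Nat.cast_nonneg _)
            refine (abs_sin_sub_le _).trans ?_
            have := pow_le_pow_left₀ (abs_nonneg _) (abs_kdot_le_of_mem_neighborFinset k hy) 3
            linarith
        _ = L * (((d : ℝ) * L * ρ) ^ 3 / 6) := by rw [← Finset.sum_mul, hS, sum_soStep_eq_one hd hL, one_mul]
    calc lam * μ * |∑ y ∈ S, soStep d L y * (((y l : ℤ) : ℝ) * (Real.sin (kdot k y) - kdot k y))|
        ≤ 3 / (d * (L : ℝ) ^ 2) * (L * (((d : ℝ) * L * ρ) ^ 3 / 6)) :=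
          mul_le_mul hlm hsum (abs_nonneg _) (by positivity)
      _ = (d : ℝ) ^ 2 * L ^ 2 * ρ ^ 3 / 2 := by field_simp; ring
  have h1 : (1 : ℝ) ≤ (d : ℝ) ^ 2 * L ^ 2 := by nlinarith [one_le_pow₀ (n := 2) hd1, one_le_pow₀ (n := 2) hL1]
  have hρ3 : 0 ≤ ρ ^ 3 := by positivity
  rw [hE]
  calc |ν / d * (Real.sin (k l) - k l) -
        lam * μ * ∑ y ∈ S, soStep d L y * (((y l : ℤ) : ℝ) * (Real.sin (kdot k y) - kdot k y))|
      ≤ ρ ^ 3 / 6 + (d : ℝ) ^ 2 * L ^ 2 * ρ ^ 3 / 2 := (abs_sub _ _).trans (add_le_add hA hB)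
    _ ≤ (d : ℝ) ^ 2 * (L : ℝ) ^ 2 * ρ ^ 3 := by nlinarith

/-- **Second-order matched Taylor bound**: `|E_2(k)| ≤ 2dL²‖k‖²_∞` when `ν = λμσ²`
(`E_2 = (ν/d) cos k_l - λμ Σ_y D(y) y_l² cos(k·y)`, the constants cancel by `Σ_y D(y) y_l² = σ²/d`).
[cite: LiuSlade2026, Lemma 3.4 and proof of Lemma 5.2 = A.2 (|Ê_γ(k)| ≲ |k|^{2+σ-|γ|})] -/
theorem abs_eSymbolD_two_le (hd : 1 ≤ d) (hL : 1 ≤ L) {μ ν lam : ℝ} (hν0 : 0 ≤ ν) (hν1 : ν ≤ 1)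
    (hlm0 : 0 ≤ lam * μ) (hlm : lam * μ ≤ 3 / (d * (L : ℝ) ^ 2))
    (hm2 : ν = lam * μ * soVariance d L) (l : Fin d) (k : Fin d → ℝ) :
    |eSymbolD d L μ ν lam l 2 k| ≤ 2 * (d : ℝ) * (L : ℝ) ^ 2 * ‖k‖ ^ 2 := by
  have hd0 : (0 : ℝ) < d := by exact_mod_cast (by omega : 0 < d)
  have hd1 : (1 : ℝ) ≤ d := by exact_mod_cast hd
  have hL1 : (1 : ℝ) ≤ L := by exact_mod_cast hL
  set ρ := ‖k‖ with hρ
  set S := (spreadOutGraph d L).neighborFinset 0 with hS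
  have hρ0 : 0 ≤ ρ := norm_nonneg _
  have hconst : ν / d - lam * μ * ∑ y ∈ S, soStep d L y * ((y l : ℤ) : ℝ) ^ 2 = 0 := by
    have : ∑ y ∈ S, soStep d L y * ((y l : ℤ) : ℝ) ^ 2 = soVariance d L / d := by
      rw [hS, ← sum_soStep_mul_sq l]; exact Finset.sum_congr rfl fun y _ => mul_comm _ _
    rw [this, hm2]; field_simp; ring
  have hE : eSymbolD d L μ ν lam l 2 k = -(ν / d * (1 - Real.cos (k l))) +
      lam * μ * ∑ y ∈ S, soStep d L y * (((y l : ℤ) : ℝ) ^ 2 * (1 - Real.cos (kdot k y))) := by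
    have e1 : eSymbolD d L μ ν lam l 2 k = ν / d * Real.cos (k l) -
        lam * μ * ∑ y ∈ S, soStep d L y * (((y l : ℤ) : ℝ) ^ 2 * Real.cos (kdot k y)) := by
      simp only [eSymbolD, hS, soSymbolD_two, show ((2 : ℕ) : ℝ) * (π / 2) = π by push_cast; ring,
        Real.cos_add_pi]; ring
    have e2 : ∑ y ∈ S, soStep d L y * (((y l : ℤ) : ℝ) ^ 2 * (1 - Real.cos (kdot k y))) =
        ∑ y ∈ S, soStep d L y * ((y l : ℤ) : ℝ) ^ 2 -
          ∑ y ∈ S, soStep d L y * (((y l : ℤ) : ℝ) ^ 2 * Real.cos (kdot k y)) := by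
      rw [← Finset.sum_sub_distrib]; exact Finset.sum_congr rfl fun y _ => by ring
    rw [e1, e2]; linear_combination hconst
  have hA : |ν / d * (1 - Real.cos (k l))| ≤ ρ ^ 2 / 2 := by
    rw [abs_mul, abs_of_nonneg (by positivity : 0 ≤ ν / d)]
    have h1 : |1 - Real.cos (k l)| ≤ ρ ^ 2 / 2 := by
      refine (abs_one_sub_cos_le (k l)).trans ?_
      have : (k l) ^ 2 ≤ ρ ^ 2 := by
        rw [← sq_abs]; exact pow_le_pow_left₀ (abs_nonneg _) (abs_apply_le_norm k l) 2
      linarith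
    have h2 : ν / d ≤ 1 := (div_le_one hd0).2 (hν1.trans hd1)
    calc ν / d * |1 - Real.cos (k l)| ≤ 1 * (ρ ^ 2 / 2) := mul_le_mul h2 h1 (abs_nonneg _) zero_le_one
      _ = ρ ^ 2 / 2 := one_mul _
  have hB : |lam * μ * ∑ y ∈ S, soStep d L y * (((y l : ℤ) : ℝ) ^ 2 * (1 - Real.cos (kdot k y)))| ≤
      3 / 2 * (d : ℝ) * L ^ 2 * ρ ^ 2 := by
    rw [abs_mul, abs_of_nonneg hlm0]
    have hsum : |∑ y ∈ S, soStep d L y * (((y l : ℤ) : ℝ) ^ 2 * (1 - Real.cos (kdot k y)))| ≤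
        (L : ℝ) ^ 2 * (((d : ℝ) * L * ρ) ^ 2 / 2) := by
      calc |∑ y ∈ S, soStep d L y * (((y l : ℤ) : ℝ) ^ 2 * (1 - Real.cos (kdot k y)))|
          ≤ ∑ y ∈ S, |soStep d L y * (((y l : ℤ) : ℝ) ^ 2 * (1 - Real.cos (kdot k y)))| :=
            Finset.abs_sum_le_sum_abs _ _
        _ ≤ ∑ y ∈ S, soStep d L y * ((L : ℝ) ^ 2 * (((d : ℝ) * L * ρ) ^ 2 / 2)) := by
            refine Finset.sum_le_sum fun y hy => ?_
            rw [abs_mul, abs_of_nonneg (soStep_nonneg y), abs_mul]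
            refine mul_le_mul_of_nonneg_left ?_ (soStep_nonneg y)
            refine mul_le_mul (abs_apply_pow_le_of_mem_neighborFinset hy l 2) ?_ (abs_nonneg _) (by positivity)
            refine (abs_one_sub_cos_le _).trans ?_
            have : (kdot k y) ^ 2 ≤ ((d : ℝ) * L * ρ) ^ 2 := by
              rw [← sq_abs]; exact pow_le_pow_left₀ (abs_nonneg _) (abs_kdot_le_of_mem_neighborFinset k hy) 2
            linarith
        _ = (L : ℝ) ^ 2 * (((d : ℝ) * L * ρ) ^ 2 / 2) := by
            rw [← Finset.sum_mul, hS, sum_soStep_eq_one hd hL, one_mul]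
    calc lam * μ * |∑ y ∈ S, soStep d L y * (((y l : ℤ) : ℝ) ^ 2 * (1 - Real.cos (kdot k y)))|
        ≤ 3 / (d * (L : ℝ) ^ 2) * ((L : ℝ) ^ 2 * (((d : ℝ) * L * ρ) ^ 2 / 2)) :=
          mul_le_mul hlm hsum (abs_nonneg _) (by positivity)
      _ = 3 / 2 * (d : ℝ) * L ^ 2 * ρ ^ 2 := by field_simp
  have h1 : (1 : ℝ) ≤ (d : ℝ) * L ^ 2 := by nlinarith [one_le_pow₀ (n := 2) hL1]
  have hρ2 : 0 ≤ ρ ^ 2 := by positivity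
  rw [hE]
  calc |-(ν / d * (1 - Real.cos (k l))) +
        lam * μ * ∑ y ∈ S, soStep d L y * (((y l : ℤ) : ℝ) ^ 2 * (1 - Real.cos (kdot k y)))|
      ≤ |-(ν / d * (1 - Real.cos (k l)))| +
        |lam * μ * ∑ y ∈ S, soStep d L y * (((y l : ℤ) : ℝ) ^ 2 * (1 - Real.cos (kdot k y)))| :=
        abs_add_le _ _
    _ ≤ ρ ^ 2 / 2 + 3 / 2 * (d : ℝ) * L ^ 2 * ρ ^ 2 := by rw [abs_neg]; exact add_le_add hA hB
    _ ≤ 2 * (d : ℝ) * (L : ℝ) ^ 2 * ρ ^ 2 := by nlinarith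

/-- **Third-order bound**: `|E_3(k)| ≤ 4L²‖k‖_∞` (`E_3 = -(ν/d) sin k_l + λμ Σ_y D(y) y_l³ sin(k·y)`,
`|sin u| ≤ |u|`; no matching needed). [cite: LiuSlade2026, proof of Lemma 5.2 = A.2] -/
theorem abs_eSymbolD_three_le (hd : 1 ≤ d) (hL : 1 ≤ L) {μ ν lam : ℝ} (hν0 : 0 ≤ ν) (hν1 : ν ≤ 1)
    (hlm0 : 0 ≤ lam * μ) (hlm : lam * μ ≤ 3 / (d * (L : ℝ) ^ 2)) (l : Fin d) (k : Fin d → ℝ) :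
    |eSymbolD d L μ ν lam l 3 k| ≤ 4 * (L : ℝ) ^ 2 * ‖k‖ := by
  have hd0 : (0 : ℝ) < d := by exact_mod_cast (by omega : 0 < d)
  have hd1 : (1 : ℝ) ≤ d := by exact_mod_cast hd
  have hL1 : (1 : ℝ) ≤ L := by exact_mod_cast hL
  set ρ := ‖k‖ with hρ
  set S := (spreadOutGraph d L).neighborFinset 0 with hS
  have hρ0 : 0 ≤ ρ := norm_nonneg _
  have hE : eSymbolD d L μ ν lam l 3 k = -(ν / d) * Real.sin (k l) +
      lam * μ * ∑ y ∈ S, soStep d L y * (((y l : ℤ) : ℝ) ^ 3 * Real.sin (kdot k y)) := by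
    simp only [eSymbolD, hS, soSymbolD_three, cos_add_three_pi_div_two]
  have hA : |-(ν / d) * Real.sin (k l)| ≤ ρ := by
    rw [abs_mul, abs_neg, abs_of_nonneg (by positivity : 0 ≤ ν / d)]
    have h2 : ν / d ≤ 1 := (div_le_one hd0).2 (hν1.trans hd1)
    calc ν / d * |Real.sin (k l)| ≤ 1 * ρ :=
          mul_le_mul h2 (Real.abs_sin_le_abs.trans (abs_apply_le_norm k l)) (abs_nonneg _) zero_le_one
      _ = ρ := one_mul _
  have hB : |lam * μ * ∑ y ∈ S, soStep d L y * (((y l : ℤ) : ℝ) ^ 3 * Real.sin (kdot k y))| ≤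
      3 * (L : ℝ) ^ 2 * ρ := by
    rw [abs_mul, abs_of_nonneg hlm0]
    have hsum : |∑ y ∈ S, soStep d L y * (((y l : ℤ) : ℝ) ^ 3 * Real.sin (kdot k y))| ≤
        (L : ℝ) ^ 3 * ((d : ℝ) * L * ρ) := by
      calc |∑ y ∈ S, soStep d L y * (((y l : ℤ) : ℝ) ^ 3 * Real.sin (kdot k y))|
          ≤ ∑ y ∈ S, |soStep d L y * (((y l : ℤ) : ℝ) ^ 3 * Real.sin (kdot k y))| :=
            Finset.abs_sum_le_sum_abs _ _
        _ ≤ ∑ y ∈ S, soStep d L y * ((L : ℝ) ^ 3 * ((d : ℝ) * L * ρ)) := by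
            refine Finset.sum_le_sum fun y hy => ?_
            rw [abs_mul, abs_of_nonneg (soStep_nonneg y), abs_mul]
            refine mul_le_mul_of_nonneg_left ?_ (soStep_nonneg y)
            exact mul_le_mul (abs_apply_pow_le_of_mem_neighborFinset hy l 3)
              (Real.abs_sin_le_abs.trans (abs_kdot_le_of_mem_neighborFinset k hy)) (abs_nonneg _)
              (by positivity)
        _ = (L : ℝ) ^ 3 * ((d : ℝ) * L * ρ) := by rw [← Finset.sum_mul, hS, sum_soStep_eq_one hd hL, one_mul]
    calc lam * μ * |∑ y ∈ S, soStep d L y * (((y l : ℤ) : ℝ) ^ 3 * Real.sin (kdot k y))|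
        ≤ 3 / (d * (L : ℝ) ^ 2) * ((L : ℝ) ^ 3 * ((d : ℝ) * L * ρ)) :=
          mul_le_mul hlm hsum (abs_nonneg _) (by positivity)
      _ = 3 * (L : ℝ) ^ 2 * ρ := by field_simp
  have h1 : ρ ≤ (L : ℝ) ^ 2 * ρ := le_mul_of_one_le_left hρ0 (one_le_pow₀ hL1)
  rw [hE]
  calc |-(ν / d) * Real.sin (k l) + lam * μ * ∑ y ∈ S, soStep d L y * (((y l : ℤ) : ℝ) ^ 3 * Real.sin (kdot k y))|
      ≤ ρ + 3 * (L : ℝ) ^ 2 * ρ := (abs_add_le _ _).trans (add_le_add hA hB)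
    _ ≤ 4 * (L : ℝ) ^ 2 * ρ := by linarith

/-- **Crude bound at every order**: `|E_j(k)| ≤ 1/d + λμ L^j` (`j ≥ 0`). [cite: LiuSlade2026, proof of Lemma 5.2 = A.2 (‖Ê_γ‖_r ≲ 1 + L^{-2}(1 + L^{|γ|-d/r}))] -/
theorem abs_eSymbolD_le (hd : 1 ≤ d) (hL : 1 ≤ L) {μ ν lam : ℝ} (hν0 : 0 ≤ ν) (hν1 : ν ≤ 1)
    (hlm0 : 0 ≤ lam * μ) (l : Fin d) (j : ℕ) (k : Fin d → ℝ) :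
    |eSymbolD d L μ ν lam l j k| ≤ 1 / d + lam * μ * (L : ℝ) ^ j := by
  have hd0 : (0 : ℝ) < d := by exact_mod_cast (by omega : 0 < d)
  unfold eSymbolD
  refine (abs_add_le _ _).trans (add_le_add ?_ ?_)
  · rw [abs_mul, abs_neg, abs_of_nonneg (by positivity : 0 ≤ ν / d)]
    calc ν / d * |Real.cos (k l + j * (π / 2))| ≤ ν / d * 1 :=
          mul_le_mul_of_nonneg_left (Real.abs_cos_le_one _) (by positivity)
      _ ≤ 1 / d := by rw [mul_one]; exact div_le_div_of_nonneg_right hν1 hd0.le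
  · rw [abs_mul, abs_of_nonneg hlm0]
    exact mul_le_mul_of_nonneg_left (abs_soSymbolD_le hd hL l j k) hlm0



/-! # Part 2. The Dirichlet-kernel bound -/

/-! ## One row: geometric and Abel bounds -/

/-- The character of one row: `e(t, m) = e^{itm}` in the tree's normal form `exp((m t) I)`. [folklore] -/
theorem cexp_row_eq_pow (t : ℝ) (m : ℕ) :
    Complex.exp ((((m : ℝ) * t : ℝ) : ℂ) * Complex.I) = Complex.exp (((t : ℝ) : ℂ) * Complex.I) ^ m := by
  rw [← Complex.exp_nat_mul]; congr 1; push_cast; ring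

/-- **Geometric bound**: `‖Σ_{m=1}^{n} e^{itm}‖ ≤ 1/|sin(t/2)|` when `sin(t/2) ≠ 0`. [folklore] -/
theorem norm_sum_range_cexp_le {t : ℝ} (ht : Real.sin (t / 2) ≠ 0) (n : ℕ) :
    ‖∑ i ∈ Finset.range n, Complex.exp (((((i + 1 : ℕ) : ℝ) * t : ℝ) : ℂ) * Complex.I)‖ ≤
      1 / |Real.sin (t / 2)| := by
  set x : ℂ := Complex.exp (((t : ℝ) : ℂ) * Complex.I) with hx
  have hx1 : ‖x‖ = 1 := Complex.norm_exp_ofReal_mul_I t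
  have hxm1 : ‖x - 1‖ = 2 * |Real.sin (t / 2)| := by
    rw [hx, mul_comm, Complex.norm_exp_I_mul_ofReal_sub_one, Real.norm_eq_abs, abs_mul, abs_two]
  have hxne : x ≠ 1 := by
    intro h
    rw [h, sub_self, norm_zero] at hxm1
    exact ht (abs_eq_zero.1 (by linarith))
  have hsum : ∑ i ∈ Finset.range n, Complex.exp (((((i + 1 : ℕ) : ℝ) * t : ℝ) : ℂ) * Complex.I) =
      x * ∑ i ∈ Finset.range n, x ^ i := by
    rw [Finset.mul_sum]
    exact Finset.sum_congr rfl fun i _ => by rw [cexp_row_eq_pow, pow_succ, mul_comm]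
  rw [hsum, geom_sum_eq hxne, norm_mul, hx1, one_mul, norm_div, hxm1]
  have h2 : ‖x ^ n - 1‖ ≤ 2 := by
    calc ‖x ^ n - 1‖ ≤ ‖x ^ n‖ + ‖(1 : ℂ)‖ := norm_sub_le _ _
      _ = 2 := by rw [norm_pow, hx1, one_pow, norm_one]; norm_num
  have hs : 0 < |Real.sin (t / 2)| := abs_pos.2 ht
  rw [div_le_div_iff₀ (by positivity) hs]
  calc ‖x ^ n - 1‖ * |Real.sin (t / 2)| ≤ 2 * |Real.sin (t / 2)| := mul_le_mul_of_nonneg_right h2 hs.le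
    _ = 1 * (2 * |Real.sin (t / 2)|) := by ring

/-- **Abel summation bound**: `‖Σ_{m=1}^{n} m^j e^{itm}‖ ≤ 2n^j/|sin(t/2)|` when `sin(t/2) ≠ 0`
(the weights `m^j` are nondecreasing). [cite: LiuSlade2026, App. B (proof of the third display of Lemma 3.6, via Hara–Slade 1990 (5.20))] -/
theorem norm_sum_range_pow_mul_cexp_le {t : ℝ} (ht : Real.sin (t / 2) ≠ 0) (j n : ℕ) :
    ‖∑ i ∈ Finset.range n, (((i + 1 : ℕ) : ℝ) : ℂ) ^ j *
        Complex.exp (((((i + 1 : ℕ) : ℝ) * t : ℝ) : ℂ) * Complex.I)‖ ≤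
      2 * (n : ℝ) ^ j / |Real.sin (t / 2)| := by
  rcases Nat.eq_zero_or_pos n with hn | hn
  · subst hn; simp; positivity
  set f : ℕ → ℂ := fun i => (((i + 1 : ℕ) : ℝ) : ℂ) ^ j with hf
  set g : ℕ → ℂ := fun i => Complex.exp (((((i + 1 : ℕ) : ℝ) * t : ℝ) : ℂ) * Complex.I) with hg
  have hs : 0 < |Real.sin (t / 2)| := abs_pos.2 ht
  have hG : ∀ m, ‖∑ i ∈ Finset.range m, g i‖ ≤ 1 / |Real.sin (t / 2)| := fun m =>
    norm_sum_range_cexp_le ht m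
  have hfR : ∀ i, f i = (((i + 1 : ℕ) : ℝ) ^ j : ℝ) := fun i => by simp [hf]
  have hfnorm : ∀ i, ‖f i‖ = ((i + 1 : ℕ) : ℝ) ^ j := fun i => by
    rw [hfR, Complex.norm_real, Real.norm_eq_abs, abs_of_nonneg (by positivity)]
  have hdiff : ∀ i, ‖f (i + 1) - f i‖ = ((i + 2 : ℕ) : ℝ) ^ j - ((i + 1 : ℕ) : ℝ) ^ j := fun i => by
    rw [hfR, hfR, ← Complex.ofReal_sub, Complex.norm_real, Real.norm_eq_abs,
      abs_of_nonneg (sub_nonneg.2 (pow_le_pow_left₀ (by positivity) (by push_cast; linarith) j))]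
  have hparts := Finset.sum_range_by_parts f g n
  simp only [smul_eq_mul] at hparts
  rw [show (∑ i ∈ Finset.range n, (((i + 1 : ℕ) : ℝ) : ℂ) ^ j *
      Complex.exp (((((i + 1 : ℕ) : ℝ) * t : ℝ) : ℂ) * Complex.I)) = ∑ i ∈ Finset.range n, f i * g i
      from rfl, hparts]
  have hn1 : n - 1 + 1 = n := Nat.sub_add_cancel hn
  calc ‖f (n - 1) * ∑ i ∈ Finset.range n, g i -
        ∑ i ∈ Finset.range (n - 1), (f (i + 1) - f i) * ∑ i ∈ Finset.range (i + 1), g i‖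
      ≤ ‖f (n - 1) * ∑ i ∈ Finset.range n, g i‖ +
        ‖∑ i ∈ Finset.range (n - 1), (f (i + 1) - f i) * ∑ i ∈ Finset.range (i + 1), g i‖ :=
        norm_sub_le _ _
    _ ≤ (n : ℝ) ^ j * (1 / |Real.sin (t / 2)|) +
        ∑ i ∈ Finset.range (n - 1), (((i + 2 : ℕ) : ℝ) ^ j - ((i + 1 : ℕ) : ℝ) ^ j) * (1 / |Real.sin (t / 2)|) := by
        refine add_le_add ?_ ?_
        · rw [norm_mul, hfnorm, hn1]
          exact mul_le_mul_of_nonneg_left (hG n) (by positivity)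
        · refine (norm_sum_le _ _).trans (Finset.sum_le_sum fun i _ => ?_)
          rw [norm_mul, hdiff]
          refine mul_le_mul_of_nonneg_left (hG (i + 1)) ?_
          exact sub_nonneg.2 (pow_le_pow_left₀ (by positivity) (by push_cast; linarith) j)
    _ = ((n : ℝ) ^ j + ((n : ℝ) ^ j - 1)) * (1 / |Real.sin (t / 2)|) := by
        rw [← Finset.sum_mul, ← add_mul]
        congr 1
        have htel : ∀ m : ℕ, ∑ i ∈ Finset.range m, (((i + 2 : ℕ) : ℝ) ^ j - ((i + 1 : ℕ) : ℝ) ^ j) =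
            ((m + 1 : ℕ) : ℝ) ^ j - 1 := by
          intro m
          induction m with
          | zero => simp
          | succ m ih => rw [Finset.sum_range_succ, ih]; push_cast; ring
        rw [htel (n - 1), hn1]
    _ ≤ 2 * (n : ℝ) ^ j * (1 / |Real.sin (t / 2)|) := by
        have hle : (n : ℝ) ^ j + ((n : ℝ) ^ j - 1) ≤ 2 * (n : ℝ) ^ j := by linarith
        exact mul_le_mul_of_nonneg_right hle (div_nonneg zero_le_one (abs_nonneg _))
    _ = 2 * (n : ℝ) ^ j / |Real.sin (t / 2)| := by ring

/-- The weighted row sum `Σ_{m=-L}^{L} m^j e^{itm}`. [folklore] -/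
def rowSumPow (L j : ℕ) (t : ℝ) : ℂ :=
  ∑ m ∈ Finset.Icc (-(L : ℤ)) L, ((m : ℝ) : ℂ) ^ j * Complex.exp ((((m : ℝ) * t : ℝ) : ℂ) * Complex.I)

/-- Folding a symmetric integer interval onto `ℕ`:
`Σ_{m=-L}^{L} f(m) = f(0) + Σ_{i<L} (f(i+1) + f(-(i+1)))`. [folklore] -/
theorem sum_Icc_neg_eq_sum_range {M : Type*} [AddCommMonoid M] (f : ℤ → M) (L : ℕ) :
    ∑ m ∈ Finset.Icc (-(L : ℤ)) L, f m = f 0 + ∑ i ∈ Finset.range L, (f ((i + 1 : ℕ) : ℤ) + f (-((i + 1 : ℕ) : ℤ))) := by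
  induction L with
  | zero => simp
  | succ n ih =>
    rw [Icc_neg_succ, Finset.sum_insert, Finset.sum_insert, ih, Finset.sum_range_succ]
    · push_cast; abel
    · simp only [Finset.mem_Icc]; omega
    · simp only [Finset.mem_insert, Finset.mem_Icc]; omega

/-- **`‖Σ_{|m|≤L} m^j e^{itm}‖ ≤ 4L^j/|sin(t/2)|`** for `j ≥ 1`, `sin(t/2) ≠ 0` (Abel on each half-row).
[cite: LiuSlade2026, App. B (proof of the third display of Lemma 3.6)] -/
theorem norm_rowSumPow_le_div {t : ℝ} (ht : Real.sin (t / 2) ≠ 0) {j : ℕ} (hj : 1 ≤ j) (L : ℕ) :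
    ‖rowSumPow L j t‖ ≤ 4 * (L : ℝ) ^ j / |Real.sin (t / 2)| := by
  have hs : 0 < |Real.sin (t / 2)| := abs_pos.2 ht
  have ht' : Real.sin (-t / 2) ≠ 0 := by rw [neg_div, Real.sin_neg]; exact neg_ne_zero.2 ht
  unfold rowSumPow
  rw [sum_Icc_neg_eq_sum_range]
  simp only [Int.cast_zero, Complex.ofReal_zero, zero_pow (by omega : j ≠ 0), zero_mul, zero_add,
    Finset.sum_add_distrib]
  have hpos : ‖∑ i ∈ Finset.range L, ((((i + 1 : ℕ) : ℤ) : ℝ) : ℂ) ^ j *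
      Complex.exp ((((((i + 1 : ℕ) : ℤ) : ℝ) * t : ℝ) : ℂ) * Complex.I)‖ ≤ 2 * (L : ℝ) ^ j / |Real.sin (t / 2)| := by
    have h := norm_sum_range_pow_mul_cexp_le ht j L
    simp only [Int.cast_natCast] at h ⊢
    exact h
  have hneg : ‖∑ i ∈ Finset.range L, (((-((i + 1 : ℕ) : ℤ) : ℤ) : ℝ) : ℂ) ^ j *
      Complex.exp (((((-((i + 1 : ℕ) : ℤ) : ℤ) : ℝ) * t : ℝ) : ℂ) * Complex.I)‖ ≤ 2 * (L : ℝ) ^ j / |Real.sin (t / 2)| := by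
    have h := norm_sum_range_pow_mul_cexp_le ht' j L
    rw [show -t / 2 = -(t / 2) by ring, Real.sin_neg, abs_neg] at h
    have heq : ∑ i ∈ Finset.range L, (((-((i + 1 : ℕ) : ℤ) : ℤ) : ℝ) : ℂ) ^ j *
        Complex.exp (((((-((i + 1 : ℕ) : ℤ) : ℤ) : ℝ) * t : ℝ) : ℂ) * Complex.I) =
        (-1) ^ j * ∑ i ∈ Finset.range L, (((i + 1 : ℕ) : ℝ) : ℂ) ^ j *
          Complex.exp (((((i + 1 : ℕ) : ℝ) * -t : ℝ) : ℂ) * Complex.I) := by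
      rw [Finset.mul_sum]
      refine Finset.sum_congr rfl fun i _ => ?_
      push_cast
      rw [neg_pow ((i : ℂ) + 1) j,
        show (-((i : ℂ) + 1)) * (t : ℂ) * Complex.I = ((i : ℂ) + 1) * -(t : ℂ) * Complex.I by ring]
      ring
    rw [heq, norm_mul, norm_pow, norm_neg, norm_one, one_pow, one_mul]
    exact h
  calc ‖∑ i ∈ Finset.range L, ((((i + 1 : ℕ) : ℤ) : ℝ) : ℂ) ^ j *
          Complex.exp ((((((i + 1 : ℕ) : ℤ) : ℝ) * t : ℝ) : ℂ) * Complex.I) +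
        ∑ i ∈ Finset.range L, (((-((i + 1 : ℕ) : ℤ) : ℤ) : ℝ) : ℂ) ^ j *
          Complex.exp (((((-((i + 1 : ℕ) : ℤ) : ℤ) : ℝ) * t : ℝ) : ℂ) * Complex.I)‖
      ≤ 2 * (L : ℝ) ^ j / |Real.sin (t / 2)| + 2 * (L : ℝ) ^ j / |Real.sin (t / 2)| :=
        (norm_add_le _ _).trans (add_le_add hpos hneg)
    _ = 4 * (L : ℝ) ^ j / |Real.sin (t / 2)| := by ring

/-- The trivial bound `‖Σ_{|m|≤L} m^j e^{itm}‖ ≤ (2L+1)L^j`. [folklore] -/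
theorem norm_rowSumPow_le (L j : ℕ) (t : ℝ) : ‖rowSumPow L j t‖ ≤ (2 * L + 1) * (L : ℝ) ^ j := by
  unfold rowSumPow
  refine (norm_sum_le _ _).trans ?_
  calc ∑ m ∈ Finset.Icc (-(L : ℤ)) L, ‖((m : ℝ) : ℂ) ^ j * Complex.exp ((((m : ℝ) * t : ℝ) : ℂ) * Complex.I)‖
      ≤ ∑ _m ∈ Finset.Icc (-(L : ℤ)) L, (L : ℝ) ^ j := by
        refine Finset.sum_le_sum fun m hm => ?_
        rw [norm_mul, Complex.norm_exp_ofReal_mul_I, mul_one, norm_pow, Complex.norm_real, Real.norm_eq_abs]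
        refine pow_le_pow_left₀ (abs_nonneg _) ?_ j
        rw [Finset.mem_Icc] at hm
        rw [abs_le]; constructor <;> [skip; skip] <;> exact_mod_cast (by omega)
    _ = (2 * L + 1) * (L : ℝ) ^ j := by
        rw [Finset.sum_const, Int.card_Icc, nsmul_eq_mul,
          show (L : ℤ) + 1 - -(L : ℤ) = ((2 * L + 1 : ℕ) : ℤ) by push_cast; ring, Int.toNat_natCast]
        push_cast; ring

/-! ## Two-regime bounds through the cutoff `m_L(t) = π/max(π, L|t|)` -/

/-- Jordan: `|sin(t/2)| ≥ |t|/π` for `|t| ≤ π`. [folklore] -/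
theorem abs_div_pi_le_abs_sin_half {t : ℝ} (ht : |t| ≤ π) : |t| / π ≤ |Real.sin (t / 2)| := by
  have h := Real.mul_le_sin (x := |t| / 2) (by positivity) (by linarith)
  have e : Real.sin (|t| / 2) = |Real.sin (t / 2)| := by
    rcases abs_choice t with h1 | h1
    · rw [h1, abs_of_nonneg]
      rw [← h1]
      exact Real.sin_nonneg_of_nonneg_of_le_pi (by positivity) (by linarith [Real.pi_pos])
    · rw [h1, neg_div, Real.sin_neg, abs_of_nonpos]
      have : Real.sin (-t / 2) = -Real.sin (t / 2) := by rw [neg_div, Real.sin_neg]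
      have hnn : 0 ≤ Real.sin (-t / 2) :=
        Real.sin_nonneg_of_nonneg_of_le_pi (by linarith [abs_nonneg t]) (by linarith [Real.pi_pos])
      linarith
  rw [← e]
  calc |t| / π = 2 / π * (|t| / 2) := by ring
    _ ≤ Real.sin (|t| / 2) := h

/-- **`|G_L(t)| ≤ (2L+1) m_L(t)`** for `|t| ≤ π`, `L ≥ 1`. [cite: LiuSlade2026, App. B (proof of the third display of Lemma 3.6: the two regimes ‖k‖_∞ ≤ 1/L and > 1/L)] -/
theorem abs_dirichletRowSum_le_cutoff (hL : 1 ≤ L) {t : ℝ} (ht : |t| ≤ π) :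
    |dirichletRowSum L t| ≤ (2 * L + 1) * dirichletCutoff L t := by
  have hL1 : (1 : ℝ) ≤ L := by exact_mod_cast hL
  by_cases hsmall : (L : ℝ) * |t| ≤ π
  · have : dirichletCutoff L t = 1 := by
      unfold dirichletCutoff; rw [max_eq_left hsmall, div_self Real.pi_pos.ne']
    rw [this, mul_one]; exact abs_dirichletRowSum_le L t
  · rw [not_le] at hsmall
    have ht0 : 0 < |t| := by
      by_contra h
      have : |t| = 0 := le_antisymm (not_lt.1 h) (abs_nonneg t)
      rw [this, mul_zero] at hsmall; linarith [Real.pi_pos]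
    have hcut : dirichletCutoff L t = π / (L * |t|) := by
      unfold dirichletCutoff; rw [max_eq_right hsmall.le]
    have hsin : 0 < |Real.sin (t / 2)| := lt_of_lt_of_le (by positivity) (abs_div_pi_le_abs_sin_half ht)
    have h1 : |dirichletRowSum L t| ≤ 1 / |Real.sin (t / 2)| := by
      rw [le_div_iff₀ hsin]; exact abs_dirichletRowSum_mul_abs_sin_le L t
    have h2 : 1 / |Real.sin (t / 2)| ≤ π / |t| := by
      rw [div_le_div_iff₀ hsin ht0, one_mul]
      have := abs_div_pi_le_abs_sin_half ht
      rw [div_le_iff₀ Real.pi_pos] at this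
      linarith
    calc |dirichletRowSum L t| ≤ π / |t| := h1.trans h2
      _ ≤ (2 * L + 1) * (π / (L * |t|)) := by
          rw [mul_div_assoc', div_le_div_iff₀ ht0 (by positivity)]
          nlinarith [Real.pi_pos]
      _ = (2 * L + 1) * dirichletCutoff L t := by rw [hcut]

/-- **`‖Σ_{|m|≤L} m^j e^{itm}‖ ≤ 2(2L+1)L^j m_L(t)`** for `|t| ≤ π`, `L, j ≥ 1`.
[cite: LiuSlade2026, App. B (proof of the third display of Lemma 3.6)] -/
theorem norm_rowSumPow_le_cutoff (hL : 1 ≤ L) {j : ℕ} (hj : 1 ≤ j) {t : ℝ} (ht : |t| ≤ π) :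
    ‖rowSumPow L j t‖ ≤ 2 * (2 * L + 1) * (L : ℝ) ^ j * dirichletCutoff L t := by
  have hL1 : (1 : ℝ) ≤ L := by exact_mod_cast hL
  by_cases hsmall : (L : ℝ) * |t| ≤ π
  · have : dirichletCutoff L t = 1 := by
      unfold dirichletCutoff; rw [max_eq_left hsmall, div_self Real.pi_pos.ne']
    rw [this, mul_one]
    refine (norm_rowSumPow_le L j t).trans ?_
    have : 0 ≤ (2 * L + 1) * (L : ℝ) ^ j := by positivity
    linarith
  · rw [not_le] at hsmall
    have ht0 : 0 < |t| := by
      by_contra h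
      have : |t| = 0 := le_antisymm (not_lt.1 h) (abs_nonneg t)
      rw [this, mul_zero] at hsmall; linarith [Real.pi_pos]
    have hcut : dirichletCutoff L t = π / (L * |t|) := by
      unfold dirichletCutoff; rw [max_eq_right hsmall.le]
    have hsin : 0 < |Real.sin (t / 2)| := lt_of_lt_of_le (by positivity) (abs_div_pi_le_abs_sin_half ht)
    have h1 : ‖rowSumPow L j t‖ ≤ 4 * (L : ℝ) ^ j / |Real.sin (t / 2)| :=
      norm_rowSumPow_le_div (abs_pos.1 hsin) hj L
    have hinv : 1 / |Real.sin (t / 2)| ≤ π / |t| := by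
      rw [div_le_div_iff₀ hsin ht0, one_mul]
      have := abs_div_pi_le_abs_sin_half ht
      rw [div_le_iff₀ Real.pi_pos] at this
      linarith
    have h2 : 4 * (L : ℝ) ^ j / |Real.sin (t / 2)| ≤ 4 * (L : ℝ) ^ j * (π / |t|) := by
      calc 4 * (L : ℝ) ^ j / |Real.sin (t / 2)| = 4 * (L : ℝ) ^ j * (1 / |Real.sin (t / 2)|) := by ring
        _ ≤ 4 * (L : ℝ) ^ j * (π / |t|) :=
          mul_le_mul_of_nonneg_left hinv (by positivity : (0 : ℝ) ≤ 4 * (L : ℝ) ^ j)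
    calc ‖rowSumPow L j t‖ ≤ 4 * (L : ℝ) ^ j * (π / |t|) := h1.trans h2
      _ ≤ 2 * (2 * L + 1) * (L : ℝ) ^ j * (π / (L * |t|)) := by
          rw [mul_div_assoc', mul_div_assoc', div_le_div_iff₀ ht0 (by positivity)]
          have : 0 ≤ (L : ℝ) ^ j := by positivity
          nlinarith [Real.pi_pos, mul_nonneg this Real.pi_pos.le]
      _ = 2 * (2 * L + 1) * (L : ℝ) ^ j * dirichletCutoff L t := by rw [hcut]

/-! ## The product formula and the bound on `soSymbolD` -/

/-- **Product formula**: `Σ_{y ∈ [-L,L]^d} y_l^j e^{ik·y} = (Σ_m m^j e^{ik_lm}) Π_{i≠l} G_L(k_i)`.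
[cite: LiuSlade2026, App. B (the product structure of D̂ behind the third display of Lemma 3.6)] -/
theorem sum_box_pow_mul_cexp (L : ℕ) (l : Fin d) (j : ℕ) (k : Fin d → ℝ) :
    ∑ y ∈ box d L, (((y l : ℤ) : ℝ) : ℂ) ^ j * Complex.exp (((kdot k y : ℝ) : ℂ) * Complex.I) =
      rowSumPow L j (k l) * ∏ i ∈ Finset.univ.erase l, (dirichletRowSum L (k i) : ℂ) := by
  classical
  set g : Fin d → ℤ → ℂ := fun i m =>
    (if i = l then ((m : ℝ) : ℂ) ^ j else 1) * Complex.exp (((((m : ℝ)) * k i : ℝ) : ℂ) * Complex.I) with hg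
  have hterm : ∀ y : Site d, (((y l : ℤ) : ℝ) : ℂ) ^ j * Complex.exp (((kdot k y : ℝ) : ℂ) * Complex.I) =
      ∏ i, g i (y i) := by
    intro y
    have hexp : Complex.exp (((kdot k y : ℝ) : ℂ) * Complex.I) =
        ∏ i, Complex.exp (((((y i : ℤ) : ℝ) * k i : ℝ) : ℂ) * Complex.I) := by
      rw [← Complex.exp_sum]
      congr 1
      unfold kdot
      push_cast
      rw [Finset.sum_mul]
      exact Finset.sum_congr rfl fun i _ => by ring
    have hpow : (((y l : ℤ) : ℝ) : ℂ) ^ j = ∏ i, (if i = l then (((y i : ℤ) : ℝ) : ℂ) ^ j else 1) := by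
      rw [Finset.prod_ite_eq']; simp
    rw [hexp, hpow, ← Finset.prod_mul_distrib]
  simp_rw [hterm]
  rw [box, Finset.sum_prod_piFinset (Finset.Icc (-(L : ℤ)) L) g,
    ← Finset.mul_prod_erase Finset.univ _ (Finset.mem_univ l)]
  congr 1
  · simp only [hg, if_true, rowSumPow]
  · refine Finset.prod_congr rfl fun i hi => ?_
    have hil : i ≠ l := Finset.ne_of_mem_erase hi
    simp only [hg, if_neg hil, one_mul]
    exact sum_Icc_cexp L (k i)

/-- `|Σ_y a(y) cos(θ_y)| ≤ ‖Σ_y a(y) e^{iθ_y}‖` for real weights. [folklore] -/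
theorem abs_sum_mul_cos_le_norm_sum {ι : Type*} (s : Finset ι) (a θ : ι → ℝ) :
    |∑ y ∈ s, a y * Real.cos (θ y)| ≤ ‖∑ y ∈ s, ((a y : ℝ) : ℂ) * Complex.exp (((θ y : ℝ) : ℂ) * Complex.I)‖ := by
  have h : (∑ y ∈ s, ((a y : ℝ) : ℂ) * Complex.exp (((θ y : ℝ) : ℂ) * Complex.I)).re =
      ∑ y ∈ s, a y * Real.cos (θ y) := by
    rw [Complex.re_sum]
    refine Finset.sum_congr rfl fun y _ => ?_
    rw [Complex.re_ofReal_mul, Complex.exp_ofReal_mul_I_re]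
  rw [← h]
  exact Complex.abs_re_le_norm _

/-- **The Dirichlet-kernel bound**: `|soSymbolD d L l j k| ≤ 4 L^j M_L(k)` for `j ≥ 1`, `d, L ≥ 1`,
`k ∈ [-π,π]^d`, with `M_L = dirichletMajorant L`.
[cite: LiuSlade2026, Lemma 3.6 (third display) and App. B (‖D̂_α‖_q ≲ L^{|α|-d/q}; pointwise product form)] -/
theorem abs_soSymbolD_le_dirichletMajorant (hd : 1 ≤ d) (hL : 1 ≤ L) (l : Fin d) {j : ℕ} (hj : 1 ≤ j)
    {k : Fin d → ℝ} (hk : k ∈ cube d) :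
    |soSymbolD d L l j k| ≤ 4 * (L : ℝ) ^ j * dirichletMajorant (L : ℝ) k := by
  classical
  have hN : (0 : ℝ) < soCount d L := by exact_mod_cast soCount_pos hd hL
  have hki : ∀ i, |k i| ≤ π := fun i => by
    have := hk i (Set.mem_univ _); exact abs_le.2 ⟨this.1, this.2⟩
  -- Step 1: `|soSymbolD| ≤ N⁻¹ ‖Σ_{box} y_l^j e^{i(k·y + jπ/2)}‖`
  set S := (spreadOutGraph d L).neighborFinset 0 with hS
  have h1 : |soSymbolD d L l j k| ≤ ‖∑ y ∈ S, ((soStep d L y * ((y l : ℤ) : ℝ) ^ j : ℝ) : ℂ) *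
      Complex.exp (((kdot k y + j * (π / 2) : ℝ) : ℂ) * Complex.I)‖ := by
    have := abs_sum_mul_cos_le_norm_sum S (fun y => soStep d L y * ((y l : ℤ) : ℝ) ^ j)
      (fun y => kdot k y + j * (π / 2))
    unfold soSymbolD
    simpa only [mul_assoc] using this
  -- factor the constant phase and `N⁻¹`, extend to the box
  have h2 : ∑ y ∈ S, ((soStep d L y * ((y l : ℤ) : ℝ) ^ j : ℝ) : ℂ) *
      Complex.exp (((kdot k y + j * (π / 2) : ℝ) : ℂ) * Complex.I) =
      (((soCount d L : ℝ))⁻¹ : ℂ) * Complex.exp (((j * (π / 2) : ℝ) : ℂ) * Complex.I) *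
        ∑ y ∈ box d L, (((y l : ℤ) : ℝ) : ℂ) ^ j * Complex.exp (((kdot k y : ℝ) : ℂ) * Complex.I) := by
    rw [hS, neighborFinset_zero_eq_erase_box, Finset.mul_sum]
    rw [← Finset.sum_erase_add _ _ (zero_mem_box d L)] <;> [skip]
    · simp only [Pi.zero_apply, Int.cast_zero, Complex.ofReal_zero, zero_pow (by omega : j ≠ 0), zero_mul,
        mul_zero, add_zero]
      refine Finset.sum_congr rfl fun y hy => ?_
      have hy' : (spreadOutGraph d L).Adj 0 y := by
        have : y ∈ (spreadOutGraph d L).neighborFinset 0 := by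
          rw [neighborFinset_zero_eq_erase_box]; exact hy
        exact (SimpleGraph.mem_neighborFinset _ _ _).1 this
      rw [soStep, if_pos hy']
      push_cast
      rw [add_mul, Complex.exp_add]
      ring
  have h3 : ‖∑ y ∈ S, ((soStep d L y * ((y l : ℤ) : ℝ) ^ j : ℝ) : ℂ) *
      Complex.exp (((kdot k y + j * (π / 2) : ℝ) : ℂ) * Complex.I)‖ =
      ((soCount d L : ℝ))⁻¹ * (‖rowSumPow L j (k l)‖ * ∏ i ∈ Finset.univ.erase l, |dirichletRowSum L (k i)|) := by
    rw [h2, sum_box_pow_mul_cexp, norm_mul, norm_mul, Complex.norm_exp_ofReal_mul_I, mul_one, norm_mul,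
      norm_prod]
    congr 1
    · rw [← Complex.ofReal_inv, Complex.norm_real, Real.norm_eq_abs, abs_of_pos (inv_pos.2 hN)]
    · congr 1
      exact Finset.prod_congr rfl fun i _ => by rw [Complex.norm_real, Real.norm_eq_abs]
  -- Step 2: the one-dimensional bounds
  have hrow : ‖rowSumPow L j (k l)‖ ≤ 2 * (2 * L + 1) * (L : ℝ) ^ j * dirichletCutoff L (k l) :=
    norm_rowSumPow_le_cutoff hL hj (hki l)
  have hG : ∏ i ∈ Finset.univ.erase l, |dirichletRowSum L (k i)| ≤
      ∏ i ∈ Finset.univ.erase l, ((2 * L + 1) * dirichletCutoff L (k i)) :=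
    Finset.prod_le_prod (fun i _ => abs_nonneg _) fun i _ => abs_dirichletRowSum_le_cutoff hL (hki i)
  have hprod : (2 * (2 * L + 1) * (L : ℝ) ^ j * dirichletCutoff L (k l)) *
      ∏ i ∈ Finset.univ.erase l, ((2 * L + 1) * dirichletCutoff L (k i)) =
      2 * (2 * L + 1 : ℝ) ^ d * (L : ℝ) ^ j * dirichletMajorant (L : ℝ) k := by
    rw [Finset.prod_mul_distrib, Finset.prod_const, Finset.card_erase_of_mem (Finset.mem_univ l),
      Finset.card_univ, Fintype.card_fin, dirichletMajorant,
      ← Finset.mul_prod_erase Finset.univ (fun i => dirichletCutoff (L : ℝ) (k i)) (Finset.mem_univ l)]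
    have hd' : (2 * L + 1 : ℝ) ^ d = (2 * L + 1) * (2 * L + 1) ^ (d - 1) := by
      rw [← pow_succ', Nat.sub_add_cancel hd]
    rw [hd']; ring
  have hcnt : ((soCount d L : ℝ))⁻¹ * (2 * (2 * L + 1 : ℝ) ^ d) ≤ 4 := by
    rw [← soCount_add_one, inv_mul_le_iff₀ hN]
    have : (1 : ℝ) ≤ soCount d L := by exact_mod_cast soCount_pos hd hL
    linarith
  calc |soSymbolD d L l j k|
      ≤ ((soCount d L : ℝ))⁻¹ * (‖rowSumPow L j (k l)‖ * ∏ i ∈ Finset.univ.erase l, |dirichletRowSum L (k i)|) :=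
        h1.trans (le_of_eq h3)
    _ ≤ ((soCount d L : ℝ))⁻¹ * ((2 * (2 * L + 1) * (L : ℝ) ^ j * dirichletCutoff L (k l)) *
          ∏ i ∈ Finset.univ.erase l, ((2 * L + 1) * dirichletCutoff L (k i))) := by
        refine mul_le_mul_of_nonneg_left ?_ (inv_nonneg.2 hN.le)
        exact mul_le_mul hrow hG (Finset.prod_nonneg fun i _ => abs_nonneg _) (by
          have := (dirichletCutoff_pos (L : ℝ) (k l)).le; positivity)
    _ = ((soCount d L : ℝ))⁻¹ * (2 * (2 * L + 1 : ℝ) ^ d) * ((L : ℝ) ^ j * dirichletMajorant (L : ℝ) k) := by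
        rw [hprod]; ring
    _ ≤ 4 * ((L : ℝ) ^ j * dirichletMajorant (L : ℝ) k) :=
        mul_le_mul_of_nonneg_right hcnt (by have := (dirichletMajorant_pos (L : ℝ) k).le; positivity)
    _ = 4 * (L : ℝ) ^ j * dirichletMajorant (L : ℝ) k := by ring

/-- **The order-zero companion**: `|D̂(k)| ≤ 2 M_L(k) + 1/N_L` on `[-π,π]^d` (`d, L ≥ 1`; from
`D̂ = (Π_i G_L(k_i) - 1)/N_L` and `|G_L| ≤ (2L+1) m_L`, `(2L+1)^d = N_L + 1 ≤ 2N_L`).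
[cite: LiuSlade2026, Lemma 3.6 (third display) with |α| = 0 and App. B] -/
theorem abs_soSymbol_le_dirichletMajorant (hd : 1 ≤ d) (hL : 1 ≤ L) {k : Fin d → ℝ} (hk : k ∈ cube d) :
    |soSymbol d L k| ≤ 2 * dirichletMajorant (L : ℝ) k + ((soCount d L : ℝ))⁻¹ := by
  have hN : (0 : ℝ) < soCount d L := by exact_mod_cast soCount_pos hd hL
  have hki : ∀ i, |k i| ≤ π := fun i => by
    have := hk i (Set.mem_univ _); exact abs_le.2 ⟨this.1, this.2⟩
  have hprod : |∏ i, dirichletRowSum L (k i)| ≤ (2 * L + 1 : ℝ) ^ d * dirichletMajorant (L : ℝ) k := by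
    have hconst : (2 * L + 1 : ℝ) ^ d = ∏ _i : Fin d, (2 * L + 1 : ℝ) := by
      rw [Finset.prod_const, Finset.card_univ, Fintype.card_fin]
    rw [Finset.abs_prod, dirichletMajorant, hconst, ← Finset.prod_mul_distrib]
    exact Finset.prod_le_prod (fun i _ => abs_nonneg _) fun i _ => abs_dirichletRowSum_le_cutoff hL (hki i)
  have hM0 : 0 ≤ dirichletMajorant (L : ℝ) k := (dirichletMajorant_pos _ _).le
  rw [soSymbol_eq_prod, abs_div, abs_of_pos hN, div_le_iff₀ hN]
  calc |∏ i, dirichletRowSum L (k i) - 1| ≤ |∏ i, dirichletRowSum L (k i)| + |(1 : ℝ)| := abs_sub _ _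
    _ ≤ (2 * L + 1 : ℝ) ^ d * dirichletMajorant (L : ℝ) k + 1 := by rw [abs_one]; exact add_le_add hprod le_rfl
    _ = ((soCount d L : ℝ) + 1) * dirichletMajorant (L : ℝ) k + 1 := by rw [soCount_add_one]
    _ ≤ (2 * (soCount d L : ℝ)) * dirichletMajorant (L : ℝ) k + 1 := by
        have : (1 : ℝ) ≤ soCount d L := by exact_mod_cast soCount_pos hd hL
        nlinarith
    _ = (2 * dirichletMajorant (L : ℝ) k + ((soCount d L : ℝ))⁻¹) * soCount d L := by
        field_simp

end Literature.Barriers.CriticalPhenomena.SpreadOutIsing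

end
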